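import Literature.Topology.FourManifolds.KhConnSumStates
import Literature.Topology.FourManifolds.KhComplexFaceProofs
import Literature.Topology.FourManifolds.KhFlipDegree
import Literature.Topology.FourManifolds.LeeRasmussenMinMaxProofs
import HarnessLib

/-!
# The merge map of a connected sum of Gauss diagrams

Third brick (after `GaussDiagramsConnSum`, `KhConnSumStates`) of the diagrammatic additivity of
Rasmussen's invariant (Rasmussen (2010), Prop. 3.11; the named fact `HasRasmussenInvariant.add`
of `Rasmussen.lean`). For Gauss diagrams `G`, `H` (at least one chord each) the **merge map**

  `m : C(G) ⊗ C(H) → C(G # H)`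

of the cube complexes over the Frobenius system `A = R[X]/(X² - hX - t)` is the map induced by the
saddle cobordism from the split union `D₁ ⊔ D₂` to the connected sum `D₁ # D₂` at the base arcs:
on enhanced states it keeps the states and the labels off the base circles and multiplies the
labels of the two base circles into the label of the merged base circle (`mergeEntry`, written
with the abstract merge incidence number `KhFace.mergeInc` of `KhFaces` along the surgery relation
`GaussDiagram.connSum_surg` of `KhConnSumStates`). Since the tree has no tensor product of
complexes, `m` is recorded as a family of *bilinear* maps
`mergeMap i j k : Cⁱ(G) × Cʲ(H) → Cᵏ(G # H)` (meaningful for `k = i + j`, zero otherwise, like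
`GaussDiagram.khovanovD`).

Main results:

* `sum_mergeEntry_mul_incidence` — **`m` is a chain map**, entrywise:
  `Σ_u m(s₁, s₂; u) ⟨d u, u'⟩ = Σ_{s₁'} ⟨d s₁, s₁'⟩ m(s₁', s₂; u') + (-1)^{|σ₁|} Σ_{s₂'} ⟨d s₂, s₂'⟩ m(s₁, s₂'; u')`
  under the merge/split dichotomy for `G` and `H` (Leibniz rule with the Koszul sign of the tensor
  product; the unsigned identity is the abstract face theorem `KhFace.face_comm` for the face
  "merge the base circles / flip a chord", the signs are `edgeSign_append_castAdd/natAdd`);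
  linear form `khovanovD_mergeMap`;
* consequently `m` maps (cycle, cycle) to cycles and (boundary, cycle), (cycle, boundary) to
  boundaries (`mergeMap_mem_ker`, `mergeMap_mem_range_left/right`);
* degrees (`§ Degrees`, Lee's system `h = 0`): `m` is homogeneous of homological degree `0` and
  **filtered of quantum degree `-1`** (`qDegree_ge_of_mergeEntry_ne_zero`, `le_qMin_mergeMap`).

This is Rasmussen's map of Lemma 3.8 / the module structure of Khovanov (2006) read on enhanced
states: Khovanov (2000), §7.4; Rasmussen (2010), §3.1 (Lemma 3.8, Prop. 3.11, Fig. 3), §4.2 (the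
saddle cobordism is filtered of degree `-1`). Everything is proved; no named fact is introduced.

## References

* J. Rasmussen, *Khovanov homology and the slice genus*, Invent. Math. 182 (2010) 419–447
  (arXiv:math/0402131), Lemma 3.8, Prop. 3.11, §4.2. [cite: Rasmussen2010, Lemma 3.8]
* M. Khovanov, *A categorification of the Jones polynomial*, Duke Math. J. 101 (2000), §2.2
  (the algebra `A`), §7.4 (connected sum). [cite: Khovanov2000, §7.4]
* D. Bar-Natan, *On Khovanov's categorification of the Jones polynomial*, Algebr. Geom. Topol. 2
  (2002), §3.2 (gradings, signs). [cite: BarNatan2002, §3.2]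

## Design notes

Hypotheses `0 < G.n`, `0 < H.n` (needed by `GaussDiagram.arcEquiv`) are carried throughout; the
empty summand is a relabelling (`GaussDiagram.connSum_empty`). The abstract supplements to
`KhFaces` (`§ Abstract`: changing the strands within their classes, transport along a bijection,
block sums) are stated for arbitrary circle maps.
-/

open Function Finset

noncomputable section

namespace Literature.Topology.FourManifolds

/-! ## Abstract supplements to `KhFaces` -/

namespace KhFace

variable {X : Type*} {R : Type} [CommRing R] {h t : R}

section Strands

variable {Y Y' : Type*} {c : X → Y} {c' : X → Y'} {α β α₁ β₁ : X}

/-- The surgery relation only sees the classes of the two strands. [folklore] -/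
theorem Surg.congr (S : Surg c c' α β) (hα : c α₁ = c α) (hβ : c β₁ = c β) : Surg c c' α₁ β₁ where
  ne := by rw [hα, hβ]; exact S.ne
  rel x y := by rw [hα, hβ]; exact S.rel x y

/-- The merge incidence number only sees the classes of the strands (labels being constant on
classes). [folklore] -/
theorem mergeInc_congr [Fintype X] [DecidableEq Y'] {la mu : X → Bool}
    (hα' : c' α₁ = c' α) (hla : la α₁ = la α) (hlb : la β₁ = la β) (hmu : mu α₁ = mu α) :
    mergeInc R h t c' la mu α₁ β₁ = mergeInc R h t c' la mu α β := by
  unfold mergeInc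
  rw [hα', hla, hlb, hmu]

/-- The split incidence number only sees the classes of the strands. [folklore] -/
theorem splitInc_congr [Fintype X] [DecidableEq Y] {la mu : X → Bool}
    (hα : c α₁ = c α) (hla : la α₁ = la α) (hmu : mu α₁ = mu α) (hmb : mu β₁ = mu β) :
    splitInc R h t c la mu α₁ β₁ = splitInc R h t c la mu α β := by
  unfold splitInc
  rw [hα, hla, hmu, hmb]

/-- The edge value only sees the classes of the strands, for labellings constant on the classes
of both circle maps. [folklore] -/
theorem edgeVal_congr [Fintype X] [DecidableEq Y] [DecidableEq Y'] (k : Kind) {la mu : X → Bool}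
    (hα : c α₁ = c α) (hα' : c' α₁ = c' α) (hla : la α₁ = la α) (hlb : la β₁ = la β)
    (hmu : mu α₁ = mu α) (hmb : mu β₁ = mu β) :
    edgeVal R h t k c c' la mu α₁ β₁ = edgeVal R h t k c c' la mu α β := by
  cases k
  · exact mergeInc_congr hα' hla hlb hmu
  · exact splitInc_congr hα hla hmu hmb

/-- The edge relation only sees the classes of the two strands (classes for both circle maps, to
serve both kinds). [folklore] -/
theorem EdgeOK.congr {k : Kind} (hk : EdgeOK k c c' α β) (hα : c α₁ = c α) (hβ : c β₁ = c β)
    (hα' : c' α₁ = c' α) (hβ' : c' β₁ = c' β) : EdgeOK k c c' α₁ β₁ := by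
  cases k
  · exact Surg.congr hk hα hβ
  · exact Surg.congr hk hα' hβ'

end Strands

section Transport

variable {X' : Type*} {Y Y' : Type*} {c : X' → Y} {c' : X' → Y'} {α β : X'}

/-- Transport of the surgery relation along a bijection of arcs. [folklore] -/
theorem Surg.comp_equiv (S : Surg c c' α β) (e : X ≃ X') :
    Surg (c ∘ e) (c' ∘ e) (e.symm α) (e.symm β) where
  ne := by simpa using S.ne
  rel x y := by simpa using S.rel (e x) (e y)

/-- Transport of the merge incidence number along a bijection of arcs. [folklore] -/
theorem mergeInc_comp_equiv [Fintype X] [Fintype X'] [DecidableEq Y'] (e : X ≃ X') (la mu : X' → Bool) :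
    mergeInc R h t (c' ∘ e) (la ∘ e) (mu ∘ e) (e.symm α) (e.symm β) = mergeInc R h t c' la mu α β := by
  unfold mergeInc
  simp only [comp_apply, Equiv.apply_symm_apply]
  have this : (∀ x : X, c' (e x) ≠ c' α → mu (e x) = la (e x)) ↔ ∀ x : X', c' x ≠ c' α → mu x = la x :=
    ⟨fun H x hx ↦ by simpa using H (e.symm x) (by simpa using hx), fun H x hx ↦ H (e x) hx⟩
  by_cases H : ∀ x : X', c' x ≠ c' α → mu x = la x
  · rw [if_pos H, if_pos (this.2 H)]
  · rw [if_neg H, if_neg (fun H' ↦ H (this.1 H'))]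

/-- Transport of the split incidence number along a bijection of arcs. [folklore] -/
theorem splitInc_comp_equiv [Fintype X] [Fintype X'] [DecidableEq Y] (e : X ≃ X') (la mu : X' → Bool) :
    splitInc R h t (c ∘ e) (la ∘ e) (mu ∘ e) (e.symm α) (e.symm β) = splitInc R h t c la mu α β := by
  unfold splitInc
  simp only [comp_apply, Equiv.apply_symm_apply]
  have this : (∀ x : X, c (e x) ≠ c α → mu (e x) = la (e x)) ↔ ∀ x : X', c x ≠ c α → mu x = la x :=
    ⟨fun H x hx ↦ by simpa using H (e.symm x) (by simpa using hx), fun H x hx ↦ H (e x) hx⟩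
  by_cases H : ∀ x : X', c x ≠ c α → mu x = la x
  · rw [if_pos H, if_pos (this.2 H)]
  · rw [if_neg H, if_neg (fun H' ↦ H (this.1 H'))]

/-- Transport of the edge value along a bijection of arcs. [folklore] -/
theorem edgeVal_comp_equiv [Fintype X] [Fintype X'] [DecidableEq Y] [DecidableEq Y'] (k : Kind)
    (e : X ≃ X') (la mu : X' → Bool) :
    edgeVal R h t k (c ∘ e) (c' ∘ e) (la ∘ e) (mu ∘ e) (e.symm α) (e.symm β) =
      edgeVal R h t k c c' la mu α β := by
  cases k
  · exact mergeInc_comp_equiv e la mu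
  · exact splitInc_comp_equiv e la mu

/-- Transport of the edge relation along a bijection of arcs. [folklore] -/
theorem EdgeOK.comp_equiv {k : Kind} (hk : EdgeOK k c c' α β) (e : X ≃ X') :
    EdgeOK k (c ∘ e) (c' ∘ e) (e.symm α) (e.symm β) := by
  cases k
  · exact Surg.comp_equiv hk e
  · exact Surg.comp_equiv hk e

/-- Labellings transported along a bijection of arcs. [folklore] -/
def labEquiv (e : X ≃ X') (c : X' → Y) : Lab (c ∘ e) ≃ Lab c where
  toFun mu := ⟨mu.1 ∘ e.symm, fun x y hxy ↦ mu.2 _ _ (by simpa using hxy)⟩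
  invFun la := ⟨la.1 ∘ e, fun x y hxy ↦ la.2 _ _ hxy⟩
  left_inv mu := by ext x; simp
  right_inv la := by ext x; simp

end Transport

section Blocks

variable {X₂ : Type*} {Y Y' Y₂ : Type*} {c : X → Y} {c' : X → Y'} {c₂ : X₂ → Y₂} {α β : X}

/-- A surgery in the first block of a disjoint union. [folklore] -/
theorem Surg.sumMap_left (S : Surg c c' α β) (c₂ : X₂ → Y₂) :
    Surg (Sum.map c c₂) (Sum.map c' c₂) (Sum.inl α) (Sum.inl β) where
  ne := by simpa using S.ne
  rel x y := by
    rcases x with x | x <;> rcases y with y | y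
    · simpa using S.rel x y
    · simp
    · simp
    · simp

/-- A surgery in the second block of a disjoint union. [folklore] -/
theorem Surg.sumMap_right {X₁ Y₁ : Type*} (c₁ : X₁ → Y₁) {c : X → Y} {c' : X → Y'} (S : Surg c c' α β) :
    Surg (Sum.map c₁ c) (Sum.map c₁ c') (Sum.inr α) (Sum.inr β) where
  ne := by simpa using S.ne
  rel x y := by
    rcases x with x | x <;> rcases y with y | y
    · simp
    · simp
    · simp
    · simpa using S.rel x y

/-- The edge relation in the first block of a disjoint union. [folklore] -/
theorem EdgeOK.sumMap_left {k : Kind} (hk : EdgeOK k c c' α β) (c₂ : X₂ → Y₂) :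
    EdgeOK k (Sum.map c c₂) (Sum.map c' c₂) (Sum.inl α) (Sum.inl β) := by
  cases k
  · exact Surg.sumMap_left hk c₂
  · exact Surg.sumMap_left hk c₂

/-- The edge relation in the second block of a disjoint union. [folklore] -/
theorem EdgeOK.sumMap_right {X₁ Y₁ : Type*} (c₁ : X₁ → Y₁) {k : Kind} (hk : EdgeOK k c c' α β) :
    EdgeOK k (Sum.map c₁ c) (Sum.map c₁ c') (Sum.inr α) (Sum.inr β) := by
  cases k
  · exact Surg.sumMap_right c₁ hk
  · exact Surg.sumMap_right c₁ hk

variable [Fintype X] [Fintype X₂] [DecidableEq Y] [DecidableEq Y'] [DecidableEq Y₂]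

/-- **An edge in the first block of a disjoint union**: its value is the value in the block if the
labels of the second block are unchanged, and `0` otherwise. [folklore] -/
theorem edgeVal_sumMap_left (k : Kind) (la mu : X → Bool) (la₂ mu₂ : X₂ → Bool) :
    edgeVal R h t k (Sum.map c c₂) (Sum.map c' c₂) (Sum.elim la la₂) (Sum.elim mu mu₂)
        (Sum.inl α) (Sum.inl β) =
      if mu₂ = la₂ then edgeVal R h t k c c' la mu α β else 0 := by
  cases k
  · simp only [edgeVal, mergeInc, Sum.map_inl, Sum.elim_inl]
    by_cases h2 : mu₂ = la₂
    · subst h2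
      rw [if_pos rfl]
      congr 1
      refine propext ⟨fun H x hx ↦ H (Sum.inl x) (by simpa using hx), fun H x hx ↦ ?_⟩
      rcases x with x | x
      · exact H x (by simpa using hx)
      · simp
    · rw [if_neg h2, if_neg]
      intro H
      exact h2 (funext fun x ↦ H (Sum.inr x) (by simp))
  · simp only [edgeVal, splitInc, Sum.map_inl, Sum.elim_inl]
    by_cases h2 : mu₂ = la₂
    · subst h2
      rw [if_pos rfl]
      congr 1
      refine propext ⟨fun H x hx ↦ H (Sum.inl x) (by simpa using hx), fun H x hx ↦ ?_⟩
      rcases x with x | x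
      · exact H x (by simpa using hx)
      · simp
    · rw [if_neg h2, if_neg]
      intro H
      exact h2 (funext fun x ↦ H (Sum.inr x) (by simp))

/-- **An edge in the second block of a disjoint union.** [folklore] -/
theorem edgeVal_sumMap_right {X₁ Y₁ : Type*} [Fintype X₁] [DecidableEq Y₁] {c₁ : X₁ → Y₁} (k : Kind)
    (la₁ mu₁ : X₁ → Bool) (la mu : X → Bool) :
    edgeVal R h t k (Sum.map c₁ c) (Sum.map c₁ c') (Sum.elim la₁ la) (Sum.elim mu₁ mu)
        (Sum.inr α) (Sum.inr β) =
      if mu₁ = la₁ then edgeVal R h t k c c' la mu α β else 0 := by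
  cases k
  · simp only [edgeVal, mergeInc, Sum.map_inr, Sum.elim_inr]
    by_cases h1 : mu₁ = la₁
    · subst h1
      rw [if_pos rfl]
      congr 1
      refine propext ⟨fun H x hx ↦ H (Sum.inr x) (by simpa using hx), fun H x hx ↦ ?_⟩
      rcases x with x | x
      · simp
      · exact H x (by simpa using hx)
    · rw [if_neg h1, if_neg]
      intro H
      exact h1 (funext fun x ↦ H (Sum.inl x) (by simp))
  · simp only [edgeVal, splitInc, Sum.map_inr, Sum.elim_inr]
    by_cases h1 : mu₁ = la₁
    · subst h1
      rw [if_pos rfl]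
      congr 1
      refine propext ⟨fun H x hx ↦ H (Sum.inr x) (by simpa using hx), fun H x hx ↦ ?_⟩
      rcases x with x | x
      · simp
      · exact H x (by simpa using hx)
    · rw [if_neg h1, if_neg]
      intro H
      exact h1 (funext fun x ↦ H (Sum.inl x) (by simp))

/-- Labellings of a disjoint union are pairs of labellings. [folklore] -/
def labSumEquiv (c : X → Y) (c₂ : X₂ → Y₂) : Lab (Sum.map c c₂) ≃ Lab c × Lab c₂ where
  toFun la := (⟨la.1 ∘ Sum.inl, fun x y hxy ↦ la.2 _ _ (by simpa using hxy)⟩,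
    ⟨la.1 ∘ Sum.inr, fun x y hxy ↦ la.2 _ _ (by simpa using hxy)⟩)
  invFun p := ⟨Sum.elim p.1.1 p.2.1, by
    rintro (x | x) (y | y) hxy
    · exact p.1.2 x y (by simpa using hxy)
    · simp at hxy
    · simp at hxy
    · exact p.2.2 x y (by simpa using hxy)⟩
  left_inv la := by
    ext x
    rcases x with x | x <;> rfl
  right_inv p := by
    rcases p with ⟨⟨f, hf⟩, ⟨g, hg⟩⟩
    rfl

end Blocks

end KhFace

namespace GaussDiagram

variable (G H : GaussDiagram) (hG : 0 < G.n) (hH : 0 < H.n)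

/-! ## States of `G # H`: two small facts -/

/-- `Fin.append` is injective in its first argument. [folklore] -/
theorem append_left_cancel {σ₁ σ₁' : G.State} {σ₂ : H.State}
    (h : (Fin.append σ₁ σ₂ : (G.connSum H).State) = Fin.append σ₁' σ₂) : σ₁ = σ₁' := by
  funext i
  have := congrFun h (Fin.castAdd H.n i)
  rwa [Fin.append_left, Fin.append_left] at this

/-- `Fin.append` is injective in its second argument. [folklore] -/
theorem append_right_cancel {σ₁ : G.State} {σ₂ σ₂' : H.State}
    (h : (Fin.append σ₁ σ₂ : (G.connSum H).State) = Fin.append σ₁ σ₂') : σ₂ = σ₂' := by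
  funext j
  have := congrFun h (Fin.natAdd G.n j)
  rwa [Fin.append_right, Fin.append_right] at this

/-! ## The edges of the cube of `G # H`, read on blocks -/

section Edges

variable (σ₁ : G.State) (σ₂ : H.State)

/-- The local strands of a first-block chord of `G # H`, read on blocks: the outgoing strand. [folklore] -/
theorem arcEquiv_symm_arcOut_castAdd (i : Fin G.n) :
    (G.arcEquiv H hG hH).symm ((G.connSum H).arcOut ((G.connSum H).overPos (Fin.castAdd H.n i))) =
      Sum.inl (G.arcOut (G.overPos i)) := by
  rw [Equiv.symm_apply_eq, connSum_overPos_castAdd, arcOut_inlPos]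
  rfl

/-- The local strands of a second-block chord of `G # H`, read on blocks: the outgoing strand. [folklore] -/
theorem arcEquiv_symm_arcOut_natAdd (j : Fin H.n) :
    (G.arcEquiv H hG hH).symm ((G.connSum H).arcOut ((G.connSum H).overPos (Fin.natAdd G.n j))) =
      Sum.inr (H.arcOut (H.overPos j)) := by
  rw [Equiv.symm_apply_eq, connSum_overPos_natAdd, arcOut_inrPos G H hH]
  rfl

/-- The incoming strand of a first-block chord read on blocks: the incoming strand of `G`, or —
at the base point of `G` — the base arc of `H`, which lies on the circle of the base arc of `G`
in every state of `G # H`. [folklore] -/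
theorem arcEquiv_symm_arcIn_castAdd (i : Fin G.n) :
    (G.arcEquiv H hG hH).symm ((G.connSum H).arcIn ((G.connSum H).overPos (Fin.castAdd H.n i))) =
        Sum.inl (G.arcIn (G.overPos i)) ∨
      ((G.arcEquiv H hG hH).symm ((G.connSum H).arcIn ((G.connSum H).overPos (Fin.castAdd H.n i))) =
          Sum.inr H.baseArc ∧ G.arcIn (G.overPos i) = G.baseArc) := by
  rw [connSum_overPos_castAdd]
  by_cases hp : ((G.overPos i : Fin (2 * G.n)) : ℕ) = 0
  · have hp' : G.overPos i = ⟨0, by omega⟩ := Fin.ext hp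
    right
    rw [hp', arcIn_inlPos_zero G H hG hH, arcIn_zero G hG, Equiv.symm_apply_eq]
    exact ⟨rfl, rfl⟩
  · left
    rw [arcIn_inlPos_of_ne G H _ hp, Equiv.symm_apply_eq]
    rfl

/-- The incoming strand of a second-block chord read on blocks. [folklore] -/
theorem arcEquiv_symm_arcIn_natAdd (j : Fin H.n) :
    (G.arcEquiv H hG hH).symm ((G.connSum H).arcIn ((G.connSum H).overPos (Fin.natAdd G.n j))) =
        Sum.inr (H.arcIn (H.overPos j)) ∨
      ((G.arcEquiv H hG hH).symm ((G.connSum H).arcIn ((G.connSum H).overPos (Fin.natAdd G.n j))) =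
          Sum.inl G.baseArc ∧ H.arcIn (H.overPos j) = H.baseArc) := by
  rw [connSum_overPos_natAdd]
  by_cases hq : ((H.overPos j : Fin (2 * H.n)) : ℕ) = 0
  · have hq' : H.overPos j = ⟨0, by omega⟩ := Fin.ext hq
    right
    rw [hq', arcIn_inrPos_zero G H hG hH, arcIn_zero H hH, Equiv.symm_apply_eq]
    exact ⟨rfl, rfl⟩
  · left
    rw [arcIn_inrPos_of_ne G H hH _ hq, Equiv.symm_apply_eq]
    rfl

/-- The two base arcs lie on one circle of `G # H`, read on blocks (any pair of states). [folklore] -/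
theorem circleOf_arcEquiv_inr_baseArc :
    (G.connSum H).circleOf (Fin.append σ₁ σ₂) (G.arcEquiv H hG hH (Sum.inr H.baseArc)) =
      (G.connSum H).circleOf (Fin.append σ₁ σ₂) (G.arcEquiv H hG hH (Sum.inl G.baseArc)) := by
  rw [arcEquiv_inl, arcEquiv_inr, eq_comm, circleOf_inlArc_eq_inrArc_iff G H σ₁ σ₂ hG hH]
  exact ⟨rfl, rfl⟩

/-- **The edge relation of a first-block chord of `G # H`, read on blocks**, with the strands of
`G` (at the base point of `G` the incoming strand of `G # H` is the base arc of `H`, which lies on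
the same circle as the base arc of `G`, `KhFace.EdgeOK.congr`). [folklore] -/
theorem edgeOK_connSum_castAdd {i : Fin G.n}
    (hms : (G.connSum H).IsMergeAt (Fin.append σ₁ σ₂) (Fin.castAdd H.n i) ∨
      (G.connSum H).IsSplitAt (Fin.append σ₁ σ₂) (Fin.castAdd H.n i)) :
    KhFace.EdgeOK ((G.connSum H).kindAt (Fin.append σ₁ σ₂) (Fin.castAdd H.n i))
      ((G.connSum H).circleOf (Fin.append σ₁ σ₂) ∘ G.arcEquiv H hG hH)
      ((G.connSum H).circleOf (Fin.append (Function.update σ₁ i true) σ₂) ∘ G.arcEquiv H hG hH)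
      (Sum.inl (G.arcIn (G.overPos i))) (Sum.inl (G.arcOut (G.overPos i))) := by
  have hok := (edgeOK_kindAt hms (G.append_update_left H σ₁ σ₂ i true)).comp_equiv
    (G.arcEquiv H hG hH)
  rw [arcEquiv_symm_arcOut_castAdd] at hok
  rcases G.arcEquiv_symm_arcIn_castAdd H hG hH i with h1 | ⟨h1, h2⟩
  · rwa [h1] at hok
  · rw [h1] at hok
    rw [h2]
    exact hok.congr (G.circleOf_arcEquiv_inr_baseArc H hG hH σ₁ σ₂).symm rfl
      (G.circleOf_arcEquiv_inr_baseArc H hG hH _ σ₂).symm rfl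

/-- **The edge relation of a second-block chord of `G # H`, read on blocks.** [folklore] -/
theorem edgeOK_connSum_natAdd {j : Fin H.n}
    (hms : (G.connSum H).IsMergeAt (Fin.append σ₁ σ₂) (Fin.natAdd G.n j) ∨
      (G.connSum H).IsSplitAt (Fin.append σ₁ σ₂) (Fin.natAdd G.n j)) :
    KhFace.EdgeOK ((G.connSum H).kindAt (Fin.append σ₁ σ₂) (Fin.natAdd G.n j))
      ((G.connSum H).circleOf (Fin.append σ₁ σ₂) ∘ G.arcEquiv H hG hH)
      ((G.connSum H).circleOf (Fin.append σ₁ (Function.update σ₂ j true)) ∘ G.arcEquiv H hG hH)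
      (Sum.inr (H.arcIn (H.overPos j))) (Sum.inr (H.arcOut (H.overPos j))) := by
  have hok := (edgeOK_kindAt hms (G.append_update_right H σ₁ σ₂ j true)).comp_equiv
    (G.arcEquiv H hG hH)
  rw [arcEquiv_symm_arcOut_natAdd] at hok
  rcases G.arcEquiv_symm_arcIn_natAdd H hG hH j with h1 | ⟨h1, h2⟩
  · rwa [h1] at hok
  · rw [h1] at hok
    rw [h2]
    exact hok.congr (G.circleOf_arcEquiv_inr_baseArc H hG hH σ₁ σ₂) rfl
      (G.circleOf_arcEquiv_inr_baseArc H hG hH σ₁ _) rfl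

variable {R : Type} [CommRing R] (h t : R)

/-- **The edge value of a first-block chord of `G # H`, read on blocks.** [folklore] -/
theorem edgeVal_connSum_castAdd (k : KhFace.Kind) {i : Fin G.n}
    (mu : KhFace.Lab ((G.connSum H).circleOf (Fin.append σ₁ σ₂)))
    (nu : KhFace.Lab ((G.connSum H).circleOf (Fin.append (Function.update σ₁ i true) σ₂))) :
    KhFace.edgeVal R h t k ((G.connSum H).circleOf (Fin.append σ₁ σ₂))
        ((G.connSum H).circleOf (Fin.append (Function.update σ₁ i true) σ₂)) mu.1 nu.1
        ((G.connSum H).arcIn ((G.connSum H).overPos (Fin.castAdd H.n i)))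
        ((G.connSum H).arcOut ((G.connSum H).overPos (Fin.castAdd H.n i))) =
      KhFace.edgeVal R h t k ((G.connSum H).circleOf (Fin.append σ₁ σ₂) ∘ G.arcEquiv H hG hH)
        ((G.connSum H).circleOf (Fin.append (Function.update σ₁ i true) σ₂) ∘ G.arcEquiv H hG hH)
        (mu.1 ∘ G.arcEquiv H hG hH) (nu.1 ∘ G.arcEquiv H hG hH)
        (Sum.inl (G.arcIn (G.overPos i))) (Sum.inl (G.arcOut (G.overPos i))) := by
  rw [← KhFace.edgeVal_comp_equiv (R := R) (h := h) (t := t) k (G.arcEquiv H hG hH) mu.1 nu.1,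
    arcEquiv_symm_arcOut_castAdd]
  rcases G.arcEquiv_symm_arcIn_castAdd H hG hH i with h1 | ⟨h1, h2⟩
  · rw [h1]
  · rw [h1, h2]
    have hc := G.circleOf_arcEquiv_inr_baseArc H hG hH σ₁ σ₂
    have hc' := G.circleOf_arcEquiv_inr_baseArc H hG hH (Function.update σ₁ i true) σ₂
    exact KhFace.edgeVal_congr (R := R) (h := h) (t := t)
      (c := (G.connSum H).circleOf (Fin.append σ₁ σ₂) ∘ G.arcEquiv H hG hH)
      (c' := (G.connSum H).circleOf (Fin.append (Function.update σ₁ i true) σ₂) ∘ G.arcEquiv H hG hH)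
      (la := mu.1 ∘ G.arcEquiv H hG hH) (mu := nu.1 ∘ G.arcEquiv H hG hH)
      (α := Sum.inl G.baseArc) (α₁ := Sum.inr H.baseArc)
      (β := Sum.inl (G.arcOut (G.overPos i))) (β₁ := Sum.inl (G.arcOut (G.overPos i)))
      k hc hc' (mu.2 _ _ hc) rfl (nu.2 _ _ hc') rfl

/-- **The edge value of a second-block chord of `G # H`, read on blocks.** [folklore] -/
theorem edgeVal_connSum_natAdd (k : KhFace.Kind) {j : Fin H.n}
    (mu : KhFace.Lab ((G.connSum H).circleOf (Fin.append σ₁ σ₂)))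
    (nu : KhFace.Lab ((G.connSum H).circleOf (Fin.append σ₁ (Function.update σ₂ j true)))) :
    KhFace.edgeVal R h t k ((G.connSum H).circleOf (Fin.append σ₁ σ₂))
        ((G.connSum H).circleOf (Fin.append σ₁ (Function.update σ₂ j true))) mu.1 nu.1
        ((G.connSum H).arcIn ((G.connSum H).overPos (Fin.natAdd G.n j)))
        ((G.connSum H).arcOut ((G.connSum H).overPos (Fin.natAdd G.n j))) =
      KhFace.edgeVal R h t k ((G.connSum H).circleOf (Fin.append σ₁ σ₂) ∘ G.arcEquiv H hG hH)
        ((G.connSum H).circleOf (Fin.append σ₁ (Function.update σ₂ j true)) ∘ G.arcEquiv H hG hH)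
        (mu.1 ∘ G.arcEquiv H hG hH) (nu.1 ∘ G.arcEquiv H hG hH)
        (Sum.inr (H.arcIn (H.overPos j))) (Sum.inr (H.arcOut (H.overPos j))) := by
  rw [← KhFace.edgeVal_comp_equiv (R := R) (h := h) (t := t) k (G.arcEquiv H hG hH) mu.1 nu.1,
    arcEquiv_symm_arcOut_natAdd]
  rcases G.arcEquiv_symm_arcIn_natAdd H hG hH j with h1 | ⟨h1, h2⟩
  · rw [h1]
  · rw [h1, h2]
    have hc := G.circleOf_arcEquiv_inr_baseArc H hG hH σ₁ σ₂
    have hc' := G.circleOf_arcEquiv_inr_baseArc H hG hH σ₁ (Function.update σ₂ j true)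
    exact KhFace.edgeVal_congr (R := R) (h := h) (t := t)
      (c := (G.connSum H).circleOf (Fin.append σ₁ σ₂) ∘ G.arcEquiv H hG hH)
      (c' := (G.connSum H).circleOf (Fin.append σ₁ (Function.update σ₂ j true)) ∘ G.arcEquiv H hG hH)
      (la := mu.1 ∘ G.arcEquiv H hG hH) (mu := nu.1 ∘ G.arcEquiv H hG hH)
      (α := Sum.inr H.baseArc) (α₁ := Sum.inl G.baseArc)
      (β := Sum.inr (H.arcOut (H.overPos j))) (β₁ := Sum.inr (H.arcOut (H.overPos j)))
      k hc.symm hc'.symm (mu.2 _ _ hc.symm) rfl (nu.2 _ _ hc'.symm) rfl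

end Edges

/-! ## The merge map -/

section Merge

variable {R : Type} [CommRing R] (h t : R)

/-- **The entries of the merge map** `m : C(G) ⊗ C(H) → C(G # H)` on enhanced states: zero
unless the state of `u` is the pair of states of `s₁`, `s₂`, and then the abstract merge incidence
number of `KhFaces` — labels of `u` agree with those of `s₁`, `s₂` off the merged base circle, and
the label of the merged base circle comes with the structure constant
`mergeCoeff (label of the base circle of s₁) (label of the base circle of s₂) (label of the merged circle)`
of the multiplication of `A = R[X]/(X² - hX - t)`. This is the map induced by the saddle from
`D₁ ⊔ D₂` to `D₁ # D₂` (Rasmussen (2010), Lemma 3.8, the map `∂`… read at the chain level; the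
multiplication of Khovanov (2000), §2.2). [cite: Rasmussen2010, Lemma 3.8] -/
def mergeEntry (s₁ : G.EnhancedState) (s₂ : H.EnhancedState) (u : (G.connSum H).EnhancedState) : R :=
  if u.state = Fin.append s₁.state s₂.state then
    KhFace.mergeInc R h t ((G.connSum H).circleOf u.state ∘ G.arcEquiv H hG hH)
      (Sum.elim s₁.label s₂.label) (u.label ∘ G.arcEquiv H hG hH) (Sum.inl G.baseArc) (Sum.inr H.baseArc)
  else 0

/-- Entries of the merge map vanish off the paired state. [folklore] -/
theorem mergeEntry_of_ne {s₁ : G.EnhancedState} {s₂ : H.EnhancedState} {u : (G.connSum H).EnhancedState}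
    (hu : u.state ≠ Fin.append s₁.state s₂.state) : G.mergeEntry H hG hH h t s₁ s₂ u = 0 :=
  if_neg hu

/-- Entries of the merge map at the paired state with a given labelling. [folklore] -/
theorem mergeEntry_ofLab (s₁ : G.EnhancedState) (s₂ : H.EnhancedState)
    (mu : KhFace.Lab ((G.connSum H).circleOf (Fin.append s₁.state s₂.state))) :
    G.mergeEntry H hG hH h t s₁ s₂ ((G.connSum H).ofLab (Fin.append s₁.state s₂.state) mu) =
      KhFace.mergeInc R h t ((G.connSum H).circleOf (Fin.append s₁.state s₂.state) ∘ G.arcEquiv H hG hH)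
        (Sum.elim s₁.label s₂.label) (mu.1 ∘ G.arcEquiv H hG hH) (Sum.inl G.baseArc) (Sum.inr H.baseArc) :=
  if_pos rfl

/-- A nonzero entry of the merge map sits at the paired state. [folklore] -/
theorem state_eq_of_mergeEntry_ne_zero {s₁ : G.EnhancedState} {s₂ : H.EnhancedState}
    {u : (G.connSum H).EnhancedState} (hu : G.mergeEntry H hG hH h t s₁ s₂ u ≠ 0) :
    u.state = Fin.append s₁.state s₂.state := by
  by_contra hne
  exact hu (G.mergeEntry_of_ne H hG hH h t hne)

end Merge

/-! ## The merge map is a chain map -/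

section ChainMap

variable {R : Type} [CommRing R] (h t : R)

/-- **Leibniz rule, first block.** For a flip of a chord of `G`:
`Σ_u m(s₁, s₂; u) ⟨d u, u'⟩ = Σ_{s₁'} ⟨d s₁, s₁'⟩ m(s₁', s₂; u')` when `u'` sits over the pair of
states `(σ₁[i ↦ 1], σ₂)`. The unsigned identity is the abstract face theorem for the face "merge
the base circles, flip the chord `i`" (`KhFace.face_comm`); the Koszul signs agree
(`edgeSign_append_castAdd`). Khovanov (2000), Prop. 8, §7.4; Rasmussen (2010), Lemma 3.8.
[cite: Khovanov2000, §7.4] -/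
theorem sum_mergeEntry_mul_incidence_castAdd
    (hms₁ : ∀ (σ : G.State) (k : Fin G.n), σ k = false → G.IsMergeAt σ k ∨ G.IsSplitAt σ k)
    (hms₂ : ∀ (σ : H.State) (k : Fin H.n), σ k = false → H.IsMergeAt σ k ∨ H.IsSplitAt σ k)
    (s₁ : G.EnhancedState) (s₂ : H.EnhancedState) {i : Fin G.n} (hi : s₁.state i = false)
    (u' : (G.connSum H).EnhancedState)
    (hu' : u'.state = Fin.append (Function.update s₁.state i true) s₂.state) :
    ∑ u, G.mergeEntry H hG hH h t s₁ s₂ u * (G.connSum H).incidence R h t u u' =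
      ∑ s₁', G.incidence R h t s₁ s₁' * G.mergeEntry H hG hH h t s₁' s₂ u' := by
  classical
  obtain ⟨σ₁, la₁, hla₁⟩ := s₁
  obtain ⟨σ₂, la₂, hla₂⟩ := s₂
  obtain ⟨σ', nu, hnu⟩ := u'
  simp only at hi hu'
  subst hu'
  have hτi : (Fin.append σ₁ σ₂ : (G.connSum H).State) (Fin.castAdd H.n i) = false := by simp [hi]
  have hupd : (Fin.append (Function.update σ₁ i true) σ₂ : (G.connSum H).State) =
      Function.update (Fin.append σ₁ σ₂) (Fin.castAdd H.n i) true :=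
    G.append_update_left H σ₁ σ₂ i true
  have hmsτ : (G.connSum H).IsMergeAt (Fin.append σ₁ σ₂) (Fin.castAdd H.n i) ∨
      (G.connSum H).IsSplitAt (Fin.append σ₁ σ₂) (Fin.castAdd H.n i) :=
    G.dichotomy_connSum H hG hH hms₁ hms₂ _ _ hτi
  -- the labellings of the face
  have hla : ∀ x y, Sum.map (G.circleOf σ₁) (H.circleOf σ₂) x = Sum.map (G.circleOf σ₁) (H.circleOf σ₂) y →
      Sum.elim la₁ la₂ x = Sum.elim la₁ la₂ y := by
    rintro (x | x) (y | y) hxy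
    · exact (⟨σ₁, la₁, hla₁⟩ : G.EnhancedState).label_eq_of_circleOf_eq (by simpa using hxy)
    · simp at hxy
    · simp at hxy
    · exact (⟨σ₂, la₂, hla₂⟩ : H.EnhancedState).label_eq_of_circleOf_eq (by simpa using hxy)
  have hnuL : ∀ x y, (G.connSum H).circleOf (Fin.append (Function.update σ₁ i true) σ₂) x =
      (G.connSum H).circleOf (Fin.append (Function.update σ₁ i true) σ₂) y → nu x = nu y :=
    fun x y hxy ↦ (⟨_, nu, hnu⟩ : (G.connSum H).EnhancedState).label_eq_of_circleOf_eq hxy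
  have hnu' : ∀ x y,
      ((G.connSum H).circleOf (Fin.append (Function.update σ₁ i true) σ₂) ∘ G.arcEquiv H hG hH) x =
      ((G.connSum H).circleOf (Fin.append (Function.update σ₁ i true) σ₂) ∘ G.arcEquiv H hG hH) y →
      (nu ∘ G.arcEquiv H hG hH) x = (nu ∘ G.arcEquiv H hG hH) y := fun x y hxy ↦ hnuL _ _ hxy
  have hla₂' : ∀ x y, H.circleOf σ₂ x = H.circleOf σ₂ y → la₂ x = la₂ y := fun x y hxy ↦
    (⟨σ₂, la₂, hla₂⟩ : H.EnhancedState).label_eq_of_circleOf_eq hxy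
  -- ### Left-hand side: only `u` over `(σ₁, σ₂)` contribute
  have hL1 : ∀ u : (G.connSum H).EnhancedState,
      G.mergeEntry H hG hH h t ⟨σ₁, la₁, hla₁⟩ ⟨σ₂, la₂, hla₂⟩ u *
        (G.connSum H).incidence R h t u ⟨_, nu, hnu⟩ =
      if u.state = Fin.append σ₁ σ₂ then G.mergeEntry H hG hH h t ⟨σ₁, la₁, hla₁⟩ ⟨σ₂, la₂, hla₂⟩ u *
        (G.connSum H).incidence R h t u ⟨_, nu, hnu⟩ else 0 := by
    intro u
    split_ifs with hu
    · rfl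
    · rw [G.mergeEntry_of_ne H hG hH h t hu, zero_mul]
  have hL2 : ∀ mu : KhFace.Lab ((G.connSum H).circleOf (Fin.append σ₁ σ₂)),
      G.mergeEntry H hG hH h t ⟨σ₁, la₁, hla₁⟩ ⟨σ₂, la₂, hla₂⟩ ((G.connSum H).ofLab (Fin.append σ₁ σ₂) mu) *
        (G.connSum H).incidence R h t ((G.connSum H).ofLab (Fin.append σ₁ σ₂) mu) ⟨_, nu, hnu⟩ =
      (edgeSign σ₁ i : R) *
        (KhFace.edgeVal R h t KhFace.Kind.merge (Sum.map (G.circleOf σ₁) (H.circleOf σ₂))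
            ((G.connSum H).circleOf (Fin.append σ₁ σ₂) ∘ G.arcEquiv H hG hH) (Sum.elim la₁ la₂)
            (mu.1 ∘ G.arcEquiv H hG hH) (Sum.inl G.baseArc) (Sum.inr H.baseArc) *
          KhFace.edgeVal R h t ((G.connSum H).kindAt (Fin.append σ₁ σ₂) (Fin.castAdd H.n i))
            ((G.connSum H).circleOf (Fin.append σ₁ σ₂) ∘ G.arcEquiv H hG hH)
            ((G.connSum H).circleOf (Fin.append (Function.update σ₁ i true) σ₂) ∘ G.arcEquiv H hG hH)
            (mu.1 ∘ G.arcEquiv H hG hH) (nu ∘ G.arcEquiv H hG hH)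
            (Sum.inl (G.arcIn (G.overPos i))) (Sum.inl (G.arcOut (G.overPos i)))) := by
    intro mu
    rw [G.mergeEntry_ofLab H hG hH h t, incidence_eq_edgeVal h t (s := (G.connSum H).ofLab _ mu)
        (x := ⟨_, nu, hnu⟩) (i := Fin.castAdd H.n i) hmsτ hτi hupd]
    dsimp only [ofLab]
    rw [G.edgeVal_connSum_castAdd H hG hH σ₁ σ₂ h t _ mu ⟨nu, hnuL⟩, edgeSign_append_castAdd,
      KhFace.edgeVal_merge]
    ring
  rw [Finset.sum_congr rfl (fun u _ ↦ hL1 u), sum_ite_state_eq,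
    Finset.sum_congr rfl (fun mu _ ↦ hL2 mu), ← Finset.mul_sum]
  -- reindex the labellings of `G # H` by labellings of the blocks, and apply the face theorem
  have hre := Fintype.sum_equiv (KhFace.labEquiv (G.arcEquiv H hG hH) ((G.connSum H).circleOf (Fin.append σ₁ σ₂))).symm
    (fun mu : KhFace.Lab ((G.connSum H).circleOf (Fin.append σ₁ σ₂)) ↦
      KhFace.edgeVal R h t KhFace.Kind.merge (Sum.map (G.circleOf σ₁) (H.circleOf σ₂))
          ((G.connSum H).circleOf (Fin.append σ₁ σ₂) ∘ G.arcEquiv H hG hH) (Sum.elim la₁ la₂)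
          (mu.1 ∘ G.arcEquiv H hG hH) (Sum.inl G.baseArc) (Sum.inr H.baseArc) *
        KhFace.edgeVal R h t ((G.connSum H).kindAt (Fin.append σ₁ σ₂) (Fin.castAdd H.n i))
          ((G.connSum H).circleOf (Fin.append σ₁ σ₂) ∘ G.arcEquiv H hG hH)
          ((G.connSum H).circleOf (Fin.append (Function.update σ₁ i true) σ₂) ∘ G.arcEquiv H hG hH)
          (mu.1 ∘ G.arcEquiv H hG hH) (nu ∘ G.arcEquiv H hG hH)
          (Sum.inl (G.arcIn (G.overPos i))) (Sum.inl (G.arcOut (G.overPos i))))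
    (fun mu ↦
      KhFace.edgeVal R h t KhFace.Kind.merge (Sum.map (G.circleOf σ₁) (H.circleOf σ₂))
          ((G.connSum H).circleOf (Fin.append σ₁ σ₂) ∘ G.arcEquiv H hG hH) (Sum.elim la₁ la₂)
          mu.1 (Sum.inl G.baseArc) (Sum.inr H.baseArc) *
        KhFace.edgeVal R h t ((G.connSum H).kindAt (Fin.append σ₁ σ₂) (Fin.castAdd H.n i))
          ((G.connSum H).circleOf (Fin.append σ₁ σ₂) ∘ G.arcEquiv H hG hH)
          ((G.connSum H).circleOf (Fin.append (Function.update σ₁ i true) σ₂) ∘ G.arcEquiv H hG hH)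
          mu.1 (nu ∘ G.arcEquiv H hG hH)
          (Sum.inl (G.arcIn (G.overPos i))) (Sum.inl (G.arcOut (G.overPos i))))
    (fun mu ↦ rfl)
  have hface := KhFace.face_comm (R := R) (h := h) (t := t) KhFace.Kind.merge
    ((G.connSum H).kindAt (Fin.append σ₁ σ₂) (Fin.castAdd H.n i)) (G.kindAt σ₁ i) KhFace.Kind.merge
    (G.connSum_surg H σ₁ σ₂ hG hH) (G.edgeOK_connSum_castAdd H hG hH σ₁ σ₂ hmsτ)
    ((edgeOK_kindAt (hms₁ σ₁ i hi) rfl).sumMap_left (H.circleOf σ₂))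
    (G.connSum_surg H (Function.update σ₁ i true) σ₂ hG hH)
    ⟨Sum.elim la₁ la₂, hla⟩ ⟨nu ∘ G.arcEquiv H hG hH, hnu'⟩
  rw [hre, hface]
  -- ### Right-hand side: only `s₁'` over `σ₁[i ↦ 1]` contribute
  have hR1 : ∀ s₁' : G.EnhancedState,
      G.incidence R h t ⟨σ₁, la₁, hla₁⟩ s₁' * G.mergeEntry H hG hH h t s₁' ⟨σ₂, la₂, hla₂⟩ ⟨_, nu, hnu⟩ =
      if s₁'.state = Function.update σ₁ i true then
        G.incidence R h t ⟨σ₁, la₁, hla₁⟩ s₁' * G.mergeEntry H hG hH h t s₁' ⟨σ₂, la₂, hla₂⟩ ⟨_, nu, hnu⟩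
      else 0 := by
    intro s₁'
    split_ifs with hs
    · rfl
    · rw [G.mergeEntry_of_ne H hG hH h t, mul_zero]
      intro hst
      exact hs (G.append_left_cancel H hst).symm
  have hR2 : ∀ mu₁ : KhFace.Lab (G.circleOf (Function.update σ₁ i true)),
      G.incidence R h t ⟨σ₁, la₁, hla₁⟩ (G.ofLab _ mu₁) *
        G.mergeEntry H hG hH h t (G.ofLab _ mu₁) ⟨σ₂, la₂, hla₂⟩ ⟨_, nu, hnu⟩ =
      (edgeSign σ₁ i : R) *
        (KhFace.edgeVal R h t (G.kindAt σ₁ i) (G.circleOf σ₁) (G.circleOf (Function.update σ₁ i true))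
            la₁ mu₁.1 (G.arcIn (G.overPos i)) (G.arcOut (G.overPos i)) *
          KhFace.mergeInc R h t
            ((G.connSum H).circleOf (Fin.append (Function.update σ₁ i true) σ₂) ∘ G.arcEquiv H hG hH)
            (Sum.elim mu₁.1 la₂) (nu ∘ G.arcEquiv H hG hH) (Sum.inl G.baseArc) (Sum.inr H.baseArc)) := by
    intro mu₁
    rw [incidence_eq_edgeVal h t (s := ⟨σ₁, la₁, hla₁⟩) (x := G.ofLab _ mu₁) (i := i) (hms₁ σ₁ i hi) hi rfl]
    dsimp only [ofLab]
    rw [mergeEntry, if_pos rfl]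
    ring
  rw [Finset.sum_congr rfl (fun s _ ↦ hR1 s), sum_ite_state_eq,
    Finset.sum_congr rfl (fun mu _ ↦ hR2 mu), ← Finset.mul_sum]
  congr 1
  -- ### The face sum over labellings of `(σ₁[i ↦ 1], σ₂)` collapses to labellings of `σ₁[i ↦ 1]`
  rw [Fintype.sum_equiv (KhFace.labSumEquiv (G.circleOf (Function.update σ₁ i true)) (H.circleOf σ₂)) _
    (fun p ↦ KhFace.edgeVal R h t (G.kindAt σ₁ i) (Sum.map (G.circleOf σ₁) (H.circleOf σ₂))
        (Sum.map (G.circleOf (Function.update σ₁ i true)) (H.circleOf σ₂)) (Sum.elim la₁ la₂)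
        (Sum.elim p.1.1 p.2.1) (Sum.inl (G.arcIn (G.overPos i))) (Sum.inl (G.arcOut (G.overPos i))) *
      KhFace.edgeVal R h t KhFace.Kind.merge (Sum.map (G.circleOf (Function.update σ₁ i true)) (H.circleOf σ₂))
        ((G.connSum H).circleOf (Fin.append (Function.update σ₁ i true) σ₂) ∘ G.arcEquiv H hG hH)
        (Sum.elim p.1.1 p.2.1) (nu ∘ G.arcEquiv H hG hH) (Sum.inl G.baseArc) (Sum.inr H.baseArc))
    (fun mu ↦ by simp only [KhFace.labSumEquiv, Equiv.coe_fn_mk, Sum.elim_comp_inl_inr]),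
    Fintype.sum_prod_type]
  refine Finset.sum_congr rfl fun mu₁ _ ↦ ?_
  simp only [KhFace.edgeVal_sumMap_left, KhFace.edgeVal_merge, ite_mul, zero_mul]
  rw [Finset.sum_eq_single (⟨la₂, hla₂'⟩ : KhFace.Lab (H.circleOf σ₂))]
  · rw [if_pos rfl]
  · intro mu₂ _ hne
    rw [if_neg (fun h' ↦ hne (Subtype.ext h'))]
  · intro h'
    exact absurd (Finset.mem_univ _) h'


/-- **Leibniz rule, second block.** For a flip of a chord of `H`:
`Σ_u m(s₁, s₂; u) ⟨d u, u'⟩ = (-1)^{|σ₁|} Σ_{s₂'} ⟨d s₂, s₂'⟩ m(s₁, s₂'; u')` when `u'` sits over the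
pair of states `(σ₁, σ₂[j ↦ 1])`; the sign is the Koszul sign of the tensor product
(`edgeSign_append_natAdd`). Khovanov (2000), Prop. 8, §7.4. [cite: Khovanov2000, §7.4] -/
theorem sum_mergeEntry_mul_incidence_natAdd
    (hms₁ : ∀ (σ : G.State) (k : Fin G.n), σ k = false → G.IsMergeAt σ k ∨ G.IsSplitAt σ k)
    (hms₂ : ∀ (σ : H.State) (k : Fin H.n), σ k = false → H.IsMergeAt σ k ∨ H.IsSplitAt σ k)
    (s₁ : G.EnhancedState) (s₂ : H.EnhancedState) {j : Fin H.n} (hj : s₂.state j = false)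
    (u' : (G.connSum H).EnhancedState)
    (hu' : u'.state = Fin.append s₁.state (Function.update s₂.state j true)) :
    ∑ u, G.mergeEntry H hG hH h t s₁ s₂ u * (G.connSum H).incidence R h t u u' =
      (-1) ^ s₁.state.weight * ∑ s₂', H.incidence R h t s₂ s₂' * G.mergeEntry H hG hH h t s₁ s₂' u' := by
  classical
  obtain ⟨σ₁, la₁, hla₁⟩ := s₁
  obtain ⟨σ₂, la₂, hla₂⟩ := s₂
  obtain ⟨σ', nu, hnu⟩ := u'
  simp only at hj hu'
  subst hu'
  have hτj : (Fin.append σ₁ σ₂ : (G.connSum H).State) (Fin.natAdd G.n j) = false := by simp [hj]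
  have hupd : (Fin.append σ₁ (Function.update σ₂ j true) : (G.connSum H).State) =
      Function.update (Fin.append σ₁ σ₂) (Fin.natAdd G.n j) true :=
    G.append_update_right H σ₁ σ₂ j true
  have hmsτ : (G.connSum H).IsMergeAt (Fin.append σ₁ σ₂) (Fin.natAdd G.n j) ∨
      (G.connSum H).IsSplitAt (Fin.append σ₁ σ₂) (Fin.natAdd G.n j) :=
    G.dichotomy_connSum H hG hH hms₁ hms₂ _ _ hτj
  -- the labellings of the face
  have hla : ∀ x y, Sum.map (G.circleOf σ₁) (H.circleOf σ₂) x = Sum.map (G.circleOf σ₁) (H.circleOf σ₂) y →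
      Sum.elim la₁ la₂ x = Sum.elim la₁ la₂ y := by
    rintro (x | x) (y | y) hxy
    · exact (⟨σ₁, la₁, hla₁⟩ : G.EnhancedState).label_eq_of_circleOf_eq (by simpa using hxy)
    · simp at hxy
    · simp at hxy
    · exact (⟨σ₂, la₂, hla₂⟩ : H.EnhancedState).label_eq_of_circleOf_eq (by simpa using hxy)
  have hnuL : ∀ x y, (G.connSum H).circleOf (Fin.append σ₁ (Function.update σ₂ j true)) x =
      (G.connSum H).circleOf (Fin.append σ₁ (Function.update σ₂ j true)) y → nu x = nu y :=
    fun x y hxy ↦ (⟨_, nu, hnu⟩ : (G.connSum H).EnhancedState).label_eq_of_circleOf_eq hxy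
  have hnu' : ∀ x y,
      ((G.connSum H).circleOf (Fin.append σ₁ (Function.update σ₂ j true)) ∘ G.arcEquiv H hG hH) x =
      ((G.connSum H).circleOf (Fin.append σ₁ (Function.update σ₂ j true)) ∘ G.arcEquiv H hG hH) y →
      (nu ∘ G.arcEquiv H hG hH) x = (nu ∘ G.arcEquiv H hG hH) y := fun x y hxy ↦ hnuL _ _ hxy
  have hla₁' : ∀ x y, G.circleOf σ₁ x = G.circleOf σ₁ y → la₁ x = la₁ y := fun x y hxy ↦
    (⟨σ₁, la₁, hla₁⟩ : G.EnhancedState).label_eq_of_circleOf_eq hxy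
  -- ### Left-hand side: only `u` over `(σ₁, σ₂)` contribute
  have hL1 : ∀ u : (G.connSum H).EnhancedState,
      G.mergeEntry H hG hH h t ⟨σ₁, la₁, hla₁⟩ ⟨σ₂, la₂, hla₂⟩ u *
        (G.connSum H).incidence R h t u ⟨_, nu, hnu⟩ =
      if u.state = Fin.append σ₁ σ₂ then G.mergeEntry H hG hH h t ⟨σ₁, la₁, hla₁⟩ ⟨σ₂, la₂, hla₂⟩ u *
        (G.connSum H).incidence R h t u ⟨_, nu, hnu⟩ else 0 := by
    intro u
    split_ifs with hu
    · rfl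
    · rw [G.mergeEntry_of_ne H hG hH h t hu, zero_mul]
  have hL2 : ∀ mu : KhFace.Lab ((G.connSum H).circleOf (Fin.append σ₁ σ₂)),
      G.mergeEntry H hG hH h t ⟨σ₁, la₁, hla₁⟩ ⟨σ₂, la₂, hla₂⟩ ((G.connSum H).ofLab (Fin.append σ₁ σ₂) mu) *
        (G.connSum H).incidence R h t ((G.connSum H).ofLab (Fin.append σ₁ σ₂) mu) ⟨_, nu, hnu⟩ =
      ((-1) ^ σ₁.weight * edgeSign σ₂ j : R) *
        (KhFace.edgeVal R h t KhFace.Kind.merge (Sum.map (G.circleOf σ₁) (H.circleOf σ₂))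
            ((G.connSum H).circleOf (Fin.append σ₁ σ₂) ∘ G.arcEquiv H hG hH) (Sum.elim la₁ la₂)
            (mu.1 ∘ G.arcEquiv H hG hH) (Sum.inl G.baseArc) (Sum.inr H.baseArc) *
          KhFace.edgeVal R h t ((G.connSum H).kindAt (Fin.append σ₁ σ₂) (Fin.natAdd G.n j))
            ((G.connSum H).circleOf (Fin.append σ₁ σ₂) ∘ G.arcEquiv H hG hH)
            ((G.connSum H).circleOf (Fin.append σ₁ (Function.update σ₂ j true)) ∘ G.arcEquiv H hG hH)
            (mu.1 ∘ G.arcEquiv H hG hH) (nu ∘ G.arcEquiv H hG hH)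
            (Sum.inr (H.arcIn (H.overPos j))) (Sum.inr (H.arcOut (H.overPos j)))) := by
    intro mu
    rw [G.mergeEntry_ofLab H hG hH h t, incidence_eq_edgeVal h t (s := (G.connSum H).ofLab _ mu)
        (x := ⟨_, nu, hnu⟩) (i := Fin.natAdd G.n j) hmsτ hτj hupd]
    dsimp only [ofLab]
    rw [G.edgeVal_connSum_natAdd H hG hH σ₁ σ₂ h t _ mu ⟨nu, hnuL⟩, edgeSign_append_natAdd,
      KhFace.edgeVal_merge]
    push_cast
    ring
  rw [Finset.sum_congr rfl (fun u _ ↦ hL1 u), sum_ite_state_eq,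
    Finset.sum_congr rfl (fun mu _ ↦ hL2 mu), ← Finset.mul_sum]
  -- reindex the labellings of `G # H` by labellings of the blocks, and apply the face theorem
  have hre := Fintype.sum_equiv (KhFace.labEquiv (G.arcEquiv H hG hH) ((G.connSum H).circleOf (Fin.append σ₁ σ₂))).symm
    (fun mu : KhFace.Lab ((G.connSum H).circleOf (Fin.append σ₁ σ₂)) ↦
      KhFace.edgeVal R h t KhFace.Kind.merge (Sum.map (G.circleOf σ₁) (H.circleOf σ₂))
          ((G.connSum H).circleOf (Fin.append σ₁ σ₂) ∘ G.arcEquiv H hG hH) (Sum.elim la₁ la₂)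
          (mu.1 ∘ G.arcEquiv H hG hH) (Sum.inl G.baseArc) (Sum.inr H.baseArc) *
        KhFace.edgeVal R h t ((G.connSum H).kindAt (Fin.append σ₁ σ₂) (Fin.natAdd G.n j))
          ((G.connSum H).circleOf (Fin.append σ₁ σ₂) ∘ G.arcEquiv H hG hH)
          ((G.connSum H).circleOf (Fin.append σ₁ (Function.update σ₂ j true)) ∘ G.arcEquiv H hG hH)
          (mu.1 ∘ G.arcEquiv H hG hH) (nu ∘ G.arcEquiv H hG hH)
          (Sum.inr (H.arcIn (H.overPos j))) (Sum.inr (H.arcOut (H.overPos j))))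
    (fun mu ↦
      KhFace.edgeVal R h t KhFace.Kind.merge (Sum.map (G.circleOf σ₁) (H.circleOf σ₂))
          ((G.connSum H).circleOf (Fin.append σ₁ σ₂) ∘ G.arcEquiv H hG hH) (Sum.elim la₁ la₂)
          mu.1 (Sum.inl G.baseArc) (Sum.inr H.baseArc) *
        KhFace.edgeVal R h t ((G.connSum H).kindAt (Fin.append σ₁ σ₂) (Fin.natAdd G.n j))
          ((G.connSum H).circleOf (Fin.append σ₁ σ₂) ∘ G.arcEquiv H hG hH)
          ((G.connSum H).circleOf (Fin.append σ₁ (Function.update σ₂ j true)) ∘ G.arcEquiv H hG hH)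
          mu.1 (nu ∘ G.arcEquiv H hG hH)
          (Sum.inr (H.arcIn (H.overPos j))) (Sum.inr (H.arcOut (H.overPos j))))
    (fun mu ↦ rfl)
  have hface := KhFace.face_comm (R := R) (h := h) (t := t) KhFace.Kind.merge
    ((G.connSum H).kindAt (Fin.append σ₁ σ₂) (Fin.natAdd G.n j)) (H.kindAt σ₂ j) KhFace.Kind.merge
    (G.connSum_surg H σ₁ σ₂ hG hH) (G.edgeOK_connSum_natAdd H hG hH σ₁ σ₂ hmsτ)
    ((edgeOK_kindAt (hms₂ σ₂ j hj) rfl).sumMap_right (G.circleOf σ₁))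
    (G.connSum_surg H σ₁ (Function.update σ₂ j true) hG hH)
    ⟨Sum.elim la₁ la₂, hla⟩ ⟨nu ∘ G.arcEquiv H hG hH, hnu'⟩
  rw [hre, hface]
  -- ### Right-hand side: only `s₂'` over `σ₂[j ↦ 1]` contribute
  have hR1 : ∀ s₂' : H.EnhancedState,
      H.incidence R h t ⟨σ₂, la₂, hla₂⟩ s₂' * G.mergeEntry H hG hH h t ⟨σ₁, la₁, hla₁⟩ s₂' ⟨_, nu, hnu⟩ =
      if s₂'.state = Function.update σ₂ j true then
        H.incidence R h t ⟨σ₂, la₂, hla₂⟩ s₂' * G.mergeEntry H hG hH h t ⟨σ₁, la₁, hla₁⟩ s₂' ⟨_, nu, hnu⟩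
      else 0 := by
    intro s₂'
    split_ifs with hs
    · rfl
    · rw [G.mergeEntry_of_ne H hG hH h t, mul_zero]
      intro hst
      exact hs (G.append_right_cancel H hst).symm
  have hR2 : ∀ mu₂ : KhFace.Lab (H.circleOf (Function.update σ₂ j true)),
      H.incidence R h t ⟨σ₂, la₂, hla₂⟩ (H.ofLab _ mu₂) *
        G.mergeEntry H hG hH h t ⟨σ₁, la₁, hla₁⟩ (H.ofLab _ mu₂) ⟨_, nu, hnu⟩ =
      (edgeSign σ₂ j : R) *
        (KhFace.edgeVal R h t (H.kindAt σ₂ j) (H.circleOf σ₂) (H.circleOf (Function.update σ₂ j true))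
            la₂ mu₂.1 (H.arcIn (H.overPos j)) (H.arcOut (H.overPos j)) *
          KhFace.mergeInc R h t
            ((G.connSum H).circleOf (Fin.append σ₁ (Function.update σ₂ j true)) ∘ G.arcEquiv H hG hH)
            (Sum.elim la₁ mu₂.1) (nu ∘ G.arcEquiv H hG hH) (Sum.inl G.baseArc) (Sum.inr H.baseArc)) := by
    intro mu₂
    rw [incidence_eq_edgeVal h t (s := ⟨σ₂, la₂, hla₂⟩) (x := H.ofLab _ mu₂) (i := j) (hms₂ σ₂ j hj) hj rfl]
    dsimp only [ofLab]
    rw [mergeEntry, if_pos rfl]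
    ring
  rw [Finset.sum_congr rfl (fun s _ ↦ hR1 s), sum_ite_state_eq,
    Finset.sum_congr rfl (fun mu _ ↦ hR2 mu), ← Finset.mul_sum, ← mul_assoc]
  push_cast
  congr 1
  -- ### The face sum over labellings of `(σ₁, σ₂[j ↦ 1])` collapses to labellings of `σ₂[j ↦ 1]`
  rw [Fintype.sum_equiv (KhFace.labSumEquiv (G.circleOf σ₁) (H.circleOf (Function.update σ₂ j true))) _
    (fun p ↦ KhFace.edgeVal R h t (H.kindAt σ₂ j) (Sum.map (G.circleOf σ₁) (H.circleOf σ₂))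
        (Sum.map (G.circleOf σ₁) (H.circleOf (Function.update σ₂ j true))) (Sum.elim la₁ la₂)
        (Sum.elim p.1.1 p.2.1) (Sum.inr (H.arcIn (H.overPos j))) (Sum.inr (H.arcOut (H.overPos j))) *
      KhFace.edgeVal R h t KhFace.Kind.merge (Sum.map (G.circleOf σ₁) (H.circleOf (Function.update σ₂ j true)))
        ((G.connSum H).circleOf (Fin.append σ₁ (Function.update σ₂ j true)) ∘ G.arcEquiv H hG hH)
        (Sum.elim p.1.1 p.2.1) (nu ∘ G.arcEquiv H hG hH) (Sum.inl G.baseArc) (Sum.inr H.baseArc))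
    (fun mu ↦ by simp only [KhFace.labSumEquiv, Equiv.coe_fn_mk, Sum.elim_comp_inl_inr]),
    Fintype.sum_prod_type, Finset.sum_comm]
  refine Finset.sum_congr rfl fun mu₂ _ ↦ ?_
  simp only [KhFace.edgeVal_sumMap_right, KhFace.edgeVal_merge, ite_mul, zero_mul]
  rw [Finset.sum_eq_single (⟨la₁, hla₁'⟩ : KhFace.Lab (G.circleOf σ₁))]
  · rw [if_pos rfl]
  · intro mu₁ _ hne
    rw [if_neg (fun h' ↦ hne (Subtype.ext h'))]
  · intro h'
    exact absurd (Finset.mem_univ _) h'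


/-- **No flip, no contribution (left-hand side).** If `u'` sits over neither `(σ₁[i ↦ 1], σ₂)` nor
`(σ₁, σ₂[j ↦ 1])` for a `0`-smoothing, the left-hand side of the Leibniz rule vanishes. [folklore] -/
theorem sum_mergeEntry_mul_incidence_eq_zero (s₁ : G.EnhancedState) (s₂ : H.EnhancedState)
    (u' : (G.connSum H).EnhancedState)
    (h₁ : ¬ ∃ i, s₁.state i = false ∧ u'.state = Fin.append (Function.update s₁.state i true) s₂.state)
    (h₂ : ¬ ∃ j, s₂.state j = false ∧ u'.state = Fin.append s₁.state (Function.update s₂.state j true)) :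
    ∑ u, G.mergeEntry H hG hH h t s₁ s₂ u * (G.connSum H).incidence R h t u u' = 0 := by
  refine Finset.sum_eq_zero fun u _ ↦ ?_
  by_cases hm : G.mergeEntry H hG hH h t s₁ s₂ u = 0
  · rw [hm, zero_mul]
  by_cases hinc : (G.connSum H).incidence R h t u u' = 0
  · rw [hinc, mul_zero]
  exfalso
  have hst := G.state_eq_of_mergeEntry_ne_zero H hG hH h t hm
  obtain ⟨k, hk, hu'⟩ := exists_of_incidence_ne_zero hinc
  rw [hst] at hk hu'
  induction k using Fin.addCases with
  | left i =>
    rw [append_castAdd] at hk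
    exact h₁ ⟨i, hk, hu'.trans (G.append_update_left H _ _ i true).symm⟩
  | right j =>
    rw [append_natAdd] at hk
    exact h₂ ⟨j, hk, hu'.trans (G.append_update_right H _ _ j true).symm⟩

/-- No flip in `G`, no contribution of the first right-hand term. [folklore] -/
theorem sum_incidence_mul_mergeEntry_left_eq_zero (s₁ : G.EnhancedState) (s₂ : H.EnhancedState)
    (u' : (G.connSum H).EnhancedState)
    (h₁ : ¬ ∃ i, s₁.state i = false ∧ u'.state = Fin.append (Function.update s₁.state i true) s₂.state) :
    ∑ s₁', G.incidence R h t s₁ s₁' * G.mergeEntry H hG hH h t s₁' s₂ u' = 0 := by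
  refine Finset.sum_eq_zero fun s₁' _ ↦ ?_
  by_cases hinc : G.incidence R h t s₁ s₁' = 0
  · rw [hinc, zero_mul]
  by_cases hm : G.mergeEntry H hG hH h t s₁' s₂ u' = 0
  · rw [hm, mul_zero]
  exfalso
  obtain ⟨i, hi, hs₁'⟩ := exists_of_incidence_ne_zero hinc
  have hst := G.state_eq_of_mergeEntry_ne_zero H hG hH h t hm
  exact h₁ ⟨i, hi, by rw [hst, hs₁']⟩

/-- No flip in `H`, no contribution of the second right-hand term. [folklore] -/
theorem sum_incidence_mul_mergeEntry_right_eq_zero (s₁ : G.EnhancedState) (s₂ : H.EnhancedState)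
    (u' : (G.connSum H).EnhancedState)
    (h₂ : ¬ ∃ j, s₂.state j = false ∧ u'.state = Fin.append s₁.state (Function.update s₂.state j true)) :
    ∑ s₂', H.incidence R h t s₂ s₂' * G.mergeEntry H hG hH h t s₁ s₂' u' = 0 := by
  refine Finset.sum_eq_zero fun s₂' _ ↦ ?_
  by_cases hinc : H.incidence R h t s₂ s₂' = 0
  · rw [hinc, zero_mul]
  by_cases hm : G.mergeEntry H hG hH h t s₁ s₂' u' = 0
  · rw [hm, mul_zero]
  exfalso
  obtain ⟨j, hj, hs₂'⟩ := exists_of_incidence_ne_zero hinc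
  have hst := G.state_eq_of_mergeEntry_ne_zero H hG hH h t hm
  exact h₂ ⟨j, hj, by rw [hst, hs₂']⟩

/-- A flip in `G` and a flip in `H` lead to different states of `G # H`. [folklore] -/
theorem append_update_ne_append_update {σ₁ : G.State} {σ₂ : H.State} {i : Fin G.n} {j : Fin H.n}
    (hi : σ₁ i = false) :
    (Fin.append (Function.update σ₁ i true) σ₂ : (G.connSum H).State) ≠
      Fin.append σ₁ (Function.update σ₂ j true) := by
  intro heq
  have := congrFun heq (Fin.castAdd H.n i)
  rw [append_castAdd, append_castAdd, Function.update_self, hi] at this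
  exact Bool.noConfusion this

/-- **The merge map is a chain map (entrywise Leibniz rule).** For all enhanced states `s₁` of `G`,
`s₂` of `H` and `u'` of `G # H`, if every flip of `G` and of `H` is a merge or a split:
`Σ_u m(s₁, s₂; u) ⟨d u, u'⟩ = Σ_{s₁'} ⟨d s₁, s₁'⟩ m(s₁', s₂; u') + (-1)^{|σ₁|} Σ_{s₂'} ⟨d s₂, s₂'⟩ m(s₁, s₂'; u')`,
i.e. `d ∘ m = m ∘ (d ⊗ 1 + (-1)^{deg} 1 ⊗ d)`: the saddle cobordism `D₁ ⊔ D₂ → D₁ # D₂` induces a chain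
map. Khovanov (2000), §7.4; Rasmussen (2010), Lemma 3.8, §4.2. [cite: Rasmussen2010, Lemma 3.8] -/
theorem sum_mergeEntry_mul_incidence
    (hms₁ : ∀ (σ : G.State) (k : Fin G.n), σ k = false → G.IsMergeAt σ k ∨ G.IsSplitAt σ k)
    (hms₂ : ∀ (σ : H.State) (k : Fin H.n), σ k = false → H.IsMergeAt σ k ∨ H.IsSplitAt σ k)
    (s₁ : G.EnhancedState) (s₂ : H.EnhancedState) (u' : (G.connSum H).EnhancedState) :
    ∑ u, G.mergeEntry H hG hH h t s₁ s₂ u * (G.connSum H).incidence R h t u u' =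
      ∑ s₁', G.incidence R h t s₁ s₁' * G.mergeEntry H hG hH h t s₁' s₂ u' +
        (-1) ^ s₁.state.weight * ∑ s₂', H.incidence R h t s₂ s₂' * G.mergeEntry H hG hH h t s₁ s₂' u' := by
  by_cases h₁ : ∃ i, s₁.state i = false ∧ u'.state = Fin.append (Function.update s₁.state i true) s₂.state
  · obtain ⟨i, hi, hu'⟩ := h₁
    have h₂ : ¬ ∃ j, s₂.state j = false ∧ u'.state = Fin.append s₁.state (Function.update s₂.state j true) := by
      rintro ⟨j, -, hu''⟩
      exact G.append_update_ne_append_update H hi (hu'.symm.trans hu'')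
    rw [G.sum_mergeEntry_mul_incidence_castAdd H hG hH h t hms₁ hms₂ s₁ s₂ hi u' hu',
      G.sum_incidence_mul_mergeEntry_right_eq_zero H hG hH h t s₁ s₂ u' h₂, mul_zero, add_zero]
  by_cases h₂ : ∃ j, s₂.state j = false ∧ u'.state = Fin.append s₁.state (Function.update s₂.state j true)
  · obtain ⟨j, hj, hu'⟩ := h₂
    rw [G.sum_mergeEntry_mul_incidence_natAdd H hG hH h t hms₁ hms₂ s₁ s₂ hj u' hu',
      G.sum_incidence_mul_mergeEntry_left_eq_zero H hG hH h t s₁ s₂ u' h₁, zero_add]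
  rw [G.sum_mergeEntry_mul_incidence_eq_zero H hG hH h t s₁ s₂ u' h₁ h₂,
    G.sum_incidence_mul_mergeEntry_left_eq_zero H hG hH h t s₁ s₂ u' h₁,
    G.sum_incidence_mul_mergeEntry_right_eq_zero H hG hH h t s₁ s₂ u' h₂, mul_zero, add_zero]

end ChainMap


/-! ## The merge map on cochains: bilinear form and the Leibniz rule -/

section Linear

variable {R : Type} [CommRing R] (h t : R)

/-- A sum over the enhanced states of one homological degree is the sum over all enhanced states
of a function vanishing off that degree. [folklore] -/
theorem sum_degStates_eq_sum {K : GaussDiagram} (k : ℤ) (f : K.EnhancedState → R)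
    (hf : ∀ u, homDegree u ≠ k → f u = 0) : ∑ u : K.degStates k, f u.1 = ∑ u, f u := by
  classical
  rw [← Finset.sum_subtype (Finset.univ.filter fun u : K.EnhancedState ↦ homDegree u = k) (by simp) f,
    Finset.sum_filter]
  refine Finset.sum_congr rfl fun u _ ↦ ?_
  split_ifs with hu
  · rfl
  · exact (hf u hu).symm

/-- **The merge map is homogeneous of homological degree `0`**: a nonzero entry `m(s₁, s₂; u)` has
`deg u = deg s₁ + deg s₂` (weights and `n₋` add up). Rasmussen (2010), §4.2. [cite: Rasmussen2010, §4.2] -/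
theorem homDegree_eq_of_mergeEntry_ne_zero {s₁ : G.EnhancedState} {s₂ : H.EnhancedState}
    {u : (G.connSum H).EnhancedState} (hu : G.mergeEntry H hG hH h t s₁ s₂ u ≠ 0) :
    homDegree u = homDegree s₁ + homDegree s₂ := by
  have hst := G.state_eq_of_mergeEntry_ne_zero H hG hH h t hu
  simp only [homDegree, hst, weight_append, nMinus_connSum]
  push_cast
  ring

/-- **The merge map** `m : Cⁱ(G) × Cʲ(H) → Cᵏ(G # H)` on cochains (coefficient functions on enhanced
states), as a bilinear map; meaningful for `k = i + j` (for other `k` it is zero, all entries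
vanishing by `homDegree_eq_of_mergeEntry_ne_zero`). Rasmussen (2010), Lemma 3.8; Khovanov (2000),
§7.4. [cite: Rasmussen2010, Lemma 3.8] -/
def mergeMap (i j k : ℤ) :
    (G.degStates i → R) →ₗ[R] (H.degStates j → R) →ₗ[R] ((G.connSum H).degStates k → R) :=
  LinearMap.mk₂ R (fun x y u ↦ ∑ s₁, ∑ s₂, x s₁ * y s₂ * G.mergeEntry H hG hH h t s₁.1 s₂.1 u.1)
    (fun x x' y ↦ by
      funext u
      simp only [Pi.add_apply, add_mul, Finset.sum_add_distrib])
    (fun c x y ↦ by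
      funext u
      simp only [Pi.smul_apply, smul_eq_mul, Finset.mul_sum, mul_assoc])
    (fun x y y' ↦ by
      funext u
      simp only [Pi.add_apply, mul_add, add_mul, Finset.sum_add_distrib])
    (fun c x y ↦ by
      funext u
      simp only [Pi.smul_apply, smul_eq_mul, Finset.mul_sum, mul_left_comm, mul_assoc])

/-- The merge map, evaluated. [folklore] -/
theorem mergeMap_apply (i j k : ℤ) (x : G.degStates i → R) (y : H.degStates j → R)
    (u : (G.connSum H).degStates k) :
    G.mergeMap H hG hH h t i j k x y u = ∑ s₁, ∑ s₂, x s₁ * y s₂ * G.mergeEntry H hG hH h t s₁.1 s₂.1 u.1 :=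
  rfl

/-- The Koszul sign of the second tensor factor is constant in a homological degree. [folklore] -/
theorem neg_one_pow_weight_eq {i : ℤ} (s₁ : G.degStates i) :
    ((-1 : R)) ^ s₁.1.state.weight = (-1) ^ Int.toNat (i + G.nMinus) := by
  have h2 := s₁.2
  unfold homDegree at h2
  have : i + G.nMinus = (s₁.1.state.weight : ℤ) := by omega
  rw [this, Int.toNat_natCast]

/-- **The Leibniz rule for the merge map on cochains**:
`d (m(x, y)) = m(d x, y) + (-1)^{i + n₋(G)} m(x, d y)` for `x ∈ Cⁱ(G)`, `y ∈ Cʲ(H)` (with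
`k = i + j`, `i' = i + 1`, `j' = j + 1`; the target degree `k'` is arbitrary, both sides vanishing
for `k' ≠ k + 1`), if every flip of `G` and of `H` is a merge or a split. The sign
`(-1)^{i + n₋} = (-1)^{|σ₁|}` is the Koszul sign of the tensor product of the two cube complexes.
Khovanov (2000), §7.4; Rasmussen (2010), Lemma 3.8. [cite: Rasmussen2010, Lemma 3.8] -/
theorem khovanovD_mergeMap
    (hms₁ : ∀ (σ : G.State) (k : Fin G.n), σ k = false → G.IsMergeAt σ k ∨ G.IsSplitAt σ k)
    (hms₂ : ∀ (σ : H.State) (k : Fin H.n), σ k = false → H.IsMergeAt σ k ∨ H.IsSplitAt σ k)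
    {i j k i' j' : ℤ} (hk : k = i + j) (hi' : i' = i + 1) (hj' : j' = j + 1) (k' : ℤ)
    (x : G.degStates i → R) (y : H.degStates j → R) :
    (G.connSum H).khovanovD R h t k k' (G.mergeMap H hG hH h t i j k x y) =
      G.mergeMap H hG hH h t i' j k' (G.khovanovD R h t i i' x) y +
        ((-1 : R) ^ Int.toNat (i + G.nMinus)) • G.mergeMap H hG hH h t i j' k' x (H.khovanovD R h t j j' y) := by
  ext u'
  simp only [khovanovD_apply, mergeMap_apply, Pi.add_apply, Pi.smul_apply, smul_eq_mul]
  -- left-hand side: `Σ_u ⟨d u, u'⟩ Σ_{s₁ s₂} x y m = Σ_{s₁ s₂} x y Σ_u m ⟨d u, u'⟩` (all `u`)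
  have hL : ∑ u : (G.connSum H).degStates k, (G.connSum H).incidence R h t u.1 u'.1 *
      ∑ s₁, ∑ s₂, x s₁ * y s₂ * G.mergeEntry H hG hH h t s₁.1 s₂.1 u.1 =
      ∑ s₁, ∑ s₂, x s₁ * y s₂ *
        ∑ u : (G.connSum H).EnhancedState, G.mergeEntry H hG hH h t s₁.1 s₂.1 u *
          (G.connSum H).incidence R h t u u'.1 := by
    calc _ = ∑ u : (G.connSum H).degStates k, ∑ s₁, ∑ s₂, x s₁ * y s₂ *
          (G.mergeEntry H hG hH h t s₁.1 s₂.1 u.1 * (G.connSum H).incidence R h t u.1 u'.1) := by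
          refine Finset.sum_congr rfl fun u _ ↦ ?_
          rw [Finset.mul_sum]
          refine Finset.sum_congr rfl fun s₁ _ ↦ ?_
          rw [Finset.mul_sum]
          exact Finset.sum_congr rfl fun s₂ _ ↦ by ring
      _ = ∑ s₁, ∑ s₂, ∑ u : (G.connSum H).degStates k, x s₁ * y s₂ *
          (G.mergeEntry H hG hH h t s₁.1 s₂.1 u.1 * (G.connSum H).incidence R h t u.1 u'.1) := by
          rw [Finset.sum_comm]
          exact Finset.sum_congr rfl fun s₁ _ ↦ Finset.sum_comm
      _ = _ := by
          refine Finset.sum_congr rfl fun s₁ _ ↦ Finset.sum_congr rfl fun s₂ _ ↦ ?_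
          rw [← Finset.mul_sum, sum_degStates_eq_sum k (fun u ↦ G.mergeEntry H hG hH h t s₁.1 s₂.1 u *
            (G.connSum H).incidence R h t u u'.1)]
          intro u hu
          by_cases hm : G.mergeEntry H hG hH h t s₁.1 s₂.1 u = 0
          · rw [hm, zero_mul]
          · exfalso
            refine hu ?_
            rw [G.homDegree_eq_of_mergeEntry_ne_zero H hG hH h t hm, s₁.2, s₂.2, hk]
  -- first right-hand term
  have hR1 : ∑ s₁' : G.degStates i', ∑ s₂, (∑ s₁, G.incidence R h t s₁.1 s₁'.1 * x s₁) * y s₂ *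
        G.mergeEntry H hG hH h t s₁'.1 s₂.1 u'.1 =
      ∑ s₁, ∑ s₂, x s₁ * y s₂ *
        ∑ s₁' : G.EnhancedState, G.incidence R h t s₁.1 s₁' * G.mergeEntry H hG hH h t s₁' s₂.1 u'.1 := by
    calc _ = ∑ s₁' : G.degStates i', ∑ s₂, ∑ s₁, x s₁ * y s₂ *
          (G.incidence R h t s₁.1 s₁'.1 * G.mergeEntry H hG hH h t s₁'.1 s₂.1 u'.1) := by
          refine Finset.sum_congr rfl fun s₁' _ ↦ Finset.sum_congr rfl fun s₂ _ ↦ ?_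
          rw [Finset.sum_mul, Finset.sum_mul]
          exact Finset.sum_congr rfl fun s₁ _ ↦ by ring
      _ = ∑ s₂, ∑ s₁, ∑ s₁' : G.degStates i', x s₁ * y s₂ *
          (G.incidence R h t s₁.1 s₁'.1 * G.mergeEntry H hG hH h t s₁'.1 s₂.1 u'.1) := by
          rw [Finset.sum_comm]
          exact Finset.sum_congr rfl fun s₂ _ ↦ Finset.sum_comm
      _ = ∑ s₂, ∑ s₁, x s₁ * y s₂ *
          ∑ s₁' : G.EnhancedState, G.incidence R h t s₁.1 s₁' * G.mergeEntry H hG hH h t s₁' s₂.1 u'.1 := by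
          refine Finset.sum_congr rfl fun s₂ _ ↦ Finset.sum_congr rfl fun s₁ _ ↦ ?_
          rw [← Finset.mul_sum, sum_degStates_eq_sum i' (fun s₁' ↦ G.incidence R h t s₁.1 s₁' *
            G.mergeEntry H hG hH h t s₁' s₂.1 u'.1)]
          intro s₁' hs
          by_cases hinc : G.incidence R h t s₁.1 s₁' = 0
          · rw [hinc, zero_mul]
          · exfalso
            exact hs (by rw [homDegree_eq_of_incidence_ne_zero hinc, s₁.2, hi'])
      _ = _ := Finset.sum_comm
  -- second right-hand term
  have hR2 : ∑ s₁, ∑ s₂' : H.degStates j', x s₁ * (∑ s₂, H.incidence R h t s₂.1 s₂'.1 * y s₂) *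
        G.mergeEntry H hG hH h t s₁.1 s₂'.1 u'.1 =
      ∑ s₁, ∑ s₂, x s₁ * y s₂ *
        ∑ s₂' : H.EnhancedState, H.incidence R h t s₂.1 s₂' * G.mergeEntry H hG hH h t s₁.1 s₂' u'.1 := by
    refine Finset.sum_congr rfl fun s₁ _ ↦ ?_
    calc _ = ∑ s₂' : H.degStates j', ∑ s₂, x s₁ * y s₂ *
          (H.incidence R h t s₂.1 s₂'.1 * G.mergeEntry H hG hH h t s₁.1 s₂'.1 u'.1) := by
          refine Finset.sum_congr rfl fun s₂' _ ↦ ?_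
          rw [Finset.mul_sum, Finset.sum_mul]
          exact Finset.sum_congr rfl fun s₂ _ ↦ by ring
      _ = ∑ s₂, ∑ s₂' : H.degStates j', x s₁ * y s₂ *
          (H.incidence R h t s₂.1 s₂'.1 * G.mergeEntry H hG hH h t s₁.1 s₂'.1 u'.1) := Finset.sum_comm
      _ = _ := by
          refine Finset.sum_congr rfl fun s₂ _ ↦ ?_
          rw [← Finset.mul_sum, sum_degStates_eq_sum j' (fun s₂' ↦ H.incidence R h t s₂.1 s₂' *
            G.mergeEntry H hG hH h t s₁.1 s₂' u'.1)]
          intro s₂' hs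
          by_cases hinc : H.incidence R h t s₂.1 s₂' = 0
          · rw [hinc, zero_mul]
          · exfalso
            exact hs (by rw [homDegree_eq_of_incidence_ne_zero hinc, s₂.2, hj'])
  rw [hL, hR1, hR2, Finset.mul_sum, ← Finset.sum_add_distrib]
  refine Finset.sum_congr rfl fun s₁ _ ↦ ?_
  rw [Finset.mul_sum, ← Finset.sum_add_distrib]
  refine Finset.sum_congr rfl fun s₂ _ ↦ ?_
  rw [G.sum_mergeEntry_mul_incidence H hG hH h t hms₁ hms₂, ← G.neg_one_pow_weight_eq (R := R) s₁]
  ring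

/-- **`m` maps (cycle, cycle) to a cycle.** [cite: Rasmussen2010, Lemma 3.8] -/
theorem mergeMap_mem_ker
    (hms₁ : ∀ (σ : G.State) (k : Fin G.n), σ k = false → G.IsMergeAt σ k ∨ G.IsSplitAt σ k)
    (hms₂ : ∀ (σ : H.State) (k : Fin H.n), σ k = false → H.IsMergeAt σ k ∨ H.IsSplitAt σ k)
    {i j k : ℤ} (hk : k = i + j) (k' : ℤ) {x : G.degStates i → R} {y : H.degStates j → R}
    (hx : x ∈ LinearMap.ker (G.khovanovD R h t i (i + 1)))
    (hy : y ∈ LinearMap.ker (H.khovanovD R h t j (j + 1))) :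
    G.mergeMap H hG hH h t i j k x y ∈ LinearMap.ker ((G.connSum H).khovanovD R h t k k') := by
  rw [LinearMap.mem_ker] at hx hy ⊢
  rw [G.khovanovD_mergeMap H hG hH h t hms₁ hms₂ hk rfl rfl k' x y, hx, hy, map_zero, map_zero,
    LinearMap.zero_apply, smul_zero, add_zero]

/-- **`m` maps (boundary, cycle) to a boundary.** [cite: Rasmussen2010, Lemma 3.8] -/
theorem mergeMap_mem_range_left
    (hms₁ : ∀ (σ : G.State) (k : Fin G.n), σ k = false → G.IsMergeAt σ k ∨ G.IsSplitAt σ k)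
    (hms₂ : ∀ (σ : H.State) (k : Fin H.n), σ k = false → H.IsMergeAt σ k ∨ H.IsSplitAt σ k)
    {i₀ i j k₀ k : ℤ} (hi : i = i₀ + 1) (hk₀ : k₀ = i₀ + j) {x : G.degStates i → R} {y : H.degStates j → R}
    (hx : x ∈ LinearMap.range (G.khovanovD R h t i₀ i))
    (hy : y ∈ LinearMap.ker (H.khovanovD R h t j (j + 1))) :
    G.mergeMap H hG hH h t i j k x y ∈ LinearMap.range ((G.connSum H).khovanovD R h t k₀ k) := by
  obtain ⟨w, rfl⟩ := hx
  rw [LinearMap.mem_ker] at hy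
  refine ⟨G.mergeMap H hG hH h t i₀ j k₀ w y, ?_⟩
  rw [G.khovanovD_mergeMap H hG hH h t hms₁ hms₂ hk₀ hi rfl k w y, hy, map_zero, smul_zero, add_zero]

/-- **`m` maps (cycle, boundary) to a boundary.** [cite: Rasmussen2010, Lemma 3.8] -/
theorem mergeMap_mem_range_right
    (hms₁ : ∀ (σ : G.State) (k : Fin G.n), σ k = false → G.IsMergeAt σ k ∨ G.IsSplitAt σ k)
    (hms₂ : ∀ (σ : H.State) (k : Fin H.n), σ k = false → H.IsMergeAt σ k ∨ H.IsSplitAt σ k)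
    {i j₀ j k₀ k : ℤ} (hj : j = j₀ + 1) (hk₀ : k₀ = i + j₀) {x : G.degStates i → R} {y : H.degStates j → R}
    (hx : x ∈ LinearMap.ker (G.khovanovD R h t i (i + 1)))
    (hy : y ∈ LinearMap.range (H.khovanovD R h t j₀ j)) :
    G.mergeMap H hG hH h t i j k x y ∈ LinearMap.range ((G.connSum H).khovanovD R h t k₀ k) := by
  obtain ⟨w, rfl⟩ := hy
  rw [LinearMap.mem_ker] at hx
  refine ⟨((-1 : R) ^ Int.toNat (i + G.nMinus)) • G.mergeMap H hG hH h t i j₀ k₀ x w, ?_⟩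
  rw [map_smul, G.khovanovD_mergeMap H hG hH h t hms₁ hms₂ hk₀ rfl hj k x w, hx, map_zero,
    LinearMap.zero_apply, zero_add, smul_smul, ← pow_add, ← two_mul, pow_mul]
  norm_num

end Linear


/-! ## Degrees: the merge map is filtered of quantum degree `-1` (Lee's system, `h = 0`) -/

section Degrees

/-- **The quantum degree of a merged state.** For a labelling `lab` of the circles of `(σ₁, σ₂)` in
`G # H` which agrees with the labels `la₁`, `la₂` of the blocks off the merged base circle,
`qDegree = qDegree₁ + qDegree₂ + (deg z - deg x₁ - deg x₂)`, where `x₁`, `x₂` are the labels of the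
two base circles and `z` the label of the merged circle (the two base circles are replaced by one).
Bar-Natan (2002), §3.2; Rasmussen (2010), §4.2. [cite: Rasmussen2010, §4.2] -/
theorem qDegree_ofLab_connSum (σ₁ : G.State) (la₁ : G.Arc → Bool)
    (hla₁ : ∀ a b, (G.stateGraph σ₁).Adj a b → la₁ a = la₁ b) (σ₂ : H.State) (la₂ : H.Arc → Bool)
    (hla₂ : ∀ a b, (H.stateGraph σ₂).Adj a b → la₂ a = la₂ b)
    (lab : KhFace.Lab ((G.connSum H).circleOf (Fin.append σ₁ σ₂)))
    (hagree : ∀ x, ((G.connSum H).circleOf (Fin.append σ₁ σ₂) ∘ G.arcEquiv H hG hH) x ≠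
      ((G.connSum H).circleOf (Fin.append σ₁ σ₂) ∘ G.arcEquiv H hG hH) (Sum.inl G.baseArc) →
      (lab.1 ∘ G.arcEquiv H hG hH) x = Sum.elim la₁ la₂ x) :
    qDegree ((G.connSum H).ofLab (Fin.append σ₁ σ₂) lab) =
      qDegree (⟨σ₁, la₁, hla₁⟩ : G.EnhancedState) + qDegree (⟨σ₂, la₂, hla₂⟩ : H.EnhancedState) +
        (labelDeg (lab.1 (G.inlArc H G.baseArc)) - labelDeg (la₁ G.baseArc) - labelDeg (la₂ H.baseArc)) := by
  classical
  rw [qDegree_eq_sum_circleLabel, qDegree_eq_sum_circleLabel, qDegree_eq_sum_circleLabel]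
  -- the sum over the circles of `G # H`
  have hsum := G.sum_stateCircle_connSum H σ₁ σ₂ hG hH
    (fun C ↦ labelDeg (circleLabel ((G.connSum H).ofLab (Fin.append σ₁ σ₂) lab) C))
  -- first block: off the base circle the labels are those of `la₁`
  have h1 : ∑ C₁, labelDeg (circleLabel ((G.connSum H).ofLab (Fin.append σ₁ σ₂) lab)
      (G.inlCircle H σ₁ σ₂ hG hH C₁)) =
      ∑ C₁, labelDeg (circleLabel (⟨σ₁, la₁, hla₁⟩ : G.EnhancedState) C₁) -
        labelDeg (la₁ G.baseArc) + labelDeg (lab.1 (G.inlArc H G.baseArc)) := by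
    rw [← Finset.add_sum_erase _ _ (Finset.mem_univ (G.circleOf σ₁ G.baseArc)),
      ← Finset.add_sum_erase _ (fun C₁ ↦ labelDeg (circleLabel (⟨σ₁, la₁, hla₁⟩ : G.EnhancedState) C₁))
        (Finset.mem_univ (G.circleOf σ₁ G.baseArc))]
    have : ∑ C₁ ∈ Finset.univ.erase (G.circleOf σ₁ G.baseArc),
        labelDeg (circleLabel ((G.connSum H).ofLab (Fin.append σ₁ σ₂) lab) (G.inlCircle H σ₁ σ₂ hG hH C₁)) =
        ∑ C₁ ∈ Finset.univ.erase (G.circleOf σ₁ G.baseArc),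
          labelDeg (circleLabel (⟨σ₁, la₁, hla₁⟩ : G.EnhancedState) C₁) := by
      refine Finset.sum_congr rfl fun C₁ hC ↦ ?_
      rw [Finset.mem_erase] at hC
      induction C₁ using SimpleGraph.ConnectedComponent.ind with | h a => ?_
      change labelDeg (lab.1 (G.inlArc H a)) = labelDeg (la₁ a)
      congr 1
      have := hagree (Sum.inl a) (fun h' ↦ hC.1 ((G.circleOf_inlArc_eq_iff H σ₁ σ₂ hG hH a _).1 h'))
      simpa using this
    rw [this]
    change labelDeg (lab.1 (G.inlArc H G.baseArc)) + _ = labelDeg (la₁ G.baseArc) + _ - _ + _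
    ring
  -- second block: off the base circle the labels are those of `la₂`
  have h2 : ∑ C₂, labelDeg (circleLabel ((G.connSum H).ofLab (Fin.append σ₁ σ₂) lab)
      (G.inrCircle H σ₁ σ₂ hG hH C₂)) =
      ∑ C₂, labelDeg (circleLabel (⟨σ₂, la₂, hla₂⟩ : H.EnhancedState) C₂) -
        labelDeg (la₂ H.baseArc) + labelDeg (lab.1 (G.inlArc H G.baseArc)) := by
    rw [← Finset.add_sum_erase _ _ (Finset.mem_univ (H.circleOf σ₂ H.baseArc)),
      ← Finset.add_sum_erase _ (fun C₂ ↦ labelDeg (circleLabel (⟨σ₂, la₂, hla₂⟩ : H.EnhancedState) C₂))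
        (Finset.mem_univ (H.circleOf σ₂ H.baseArc))]
    have : ∑ C₂ ∈ Finset.univ.erase (H.circleOf σ₂ H.baseArc),
        labelDeg (circleLabel ((G.connSum H).ofLab (Fin.append σ₁ σ₂) lab) (G.inrCircle H σ₁ σ₂ hG hH C₂)) =
        ∑ C₂ ∈ Finset.univ.erase (H.circleOf σ₂ H.baseArc),
          labelDeg (circleLabel (⟨σ₂, la₂, hla₂⟩ : H.EnhancedState) C₂) := by
      refine Finset.sum_congr rfl fun C₂ hC ↦ ?_
      rw [Finset.mem_erase] at hC
      induction C₂ using SimpleGraph.ConnectedComponent.ind with | h b => ?_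
      change labelDeg (lab.1 (G.inrArc H b)) = labelDeg (la₂ b)
      congr 1
      have hne : (G.connSum H).circleOf (Fin.append σ₁ σ₂) (G.inrArc H b) ≠
          (G.connSum H).circleOf (Fin.append σ₁ σ₂) (G.inlArc H G.baseArc) := by
        intro h'
        exact hC.1 ((G.circleOf_inlArc_eq_inrArc_iff H σ₁ σ₂ hG hH _ b).1 h'.symm).2
      have := hagree (Sum.inr b) hne
      simpa using this
    rw [this, ← G.inlCircle_baseArc H σ₁ σ₂ hG hH]
    change labelDeg (lab.1 (G.inlArc H G.baseArc)) + _ = labelDeg (la₂ H.baseArc) + _ - _ + _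
    ring
  rw [h1, h2] at hsum
  change ∑ C, labelDeg (circleLabel ((G.connSum H).ofLab (Fin.append σ₁ σ₂) lab) C) +
    labelDeg (lab.1 (G.inlArc H G.baseArc)) = _ at hsum
  have hw : (State.weight (G := G.connSum H) (Fin.append σ₁ σ₂) : ℤ) = σ₁.weight + σ₂.weight := by
    rw [weight_append]; push_cast; rfl
  change ∑ C, labelDeg (circleLabel ((G.connSum H).ofLab (Fin.append σ₁ σ₂) lab) C) +
      (State.weight (G := G.connSum H) (Fin.append σ₁ σ₂) : ℤ) + ((G.connSum H).nPlus : ℤ) -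
      2 * ((G.connSum H).nMinus : ℤ) = _
  rw [hw, nPlus_connSum, nMinus_connSum]
  push_cast
  change _ = ∑ C₁, labelDeg (circleLabel (⟨σ₁, la₁, hla₁⟩ : G.EnhancedState) C₁) + (σ₁.weight : ℤ) + _ - _ +
    (∑ C₂, labelDeg (circleLabel (⟨σ₂, la₂, hla₂⟩ : H.EnhancedState) C₂) + (σ₂.weight : ℤ) + _ - _) + _
  linarith

/-- The structure constants of the multiplication of `A = R[X]/(X² - t)` (`h = 0`) lower the label
degree by at most one: `deg z - deg x₁ - deg x₂ ∈ {-1, 3}` whenever `mergeCoeff 0 t x₁ x₂ z ≠ 0`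
(`1·1 = 1`, `1·X = X`, `X·X = t·1`): Lee's multiplication is Khovanov's plus a term raising the
`q`-grading by `4` (Rasmussen (2010), proof of Lemma 3.5: `m' = m + Φ_m`). [cite: Rasmussen2010, Lemma 3.5] -/
theorem labelDeg_sub_ge_of_mergeCoeff_ne_zero {R : Type} [CommRing R] {t : R} {x₁ x₂ z : Bool}
    (hc : mergeCoeff R 0 t x₁ x₂ z ≠ 0) : -1 ≤ labelDeg z - labelDeg x₁ - labelDeg x₂ := by
  cases x₁ <;> cases x₂ <;> cases z <;> simp [mergeCoeff, labelDeg] at hc ⊢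

/-- **The merge map is filtered of quantum degree `-1`** (Lee's system `h = 0`): a nonzero entry
`m(s₁, s₂; u)` has `qDegree u ≥ qDegree s₁ + qDegree s₂ - 1`. This is `χ(S) = -1` for the saddle
cobordism `S : D₁ ⊔ D₂ → D₁ # D₂`; Rasmussen (2010), §4.2 (the map of an elementary cobordism of
Euler characteristic `χ` is filtered of degree `χ`), Lemma 3.8 ("the maps … are filtered of degree
`-1`"). [cite: Rasmussen2010, Lemma 3.8] -/
theorem qDegree_ge_of_mergeEntry_ne_zero {R : Type} [CommRing R] (t : R) {s₁ : G.EnhancedState}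
    {s₂ : H.EnhancedState} {u : (G.connSum H).EnhancedState}
    (hm : G.mergeEntry H hG hH 0 t s₁ s₂ u ≠ 0) : qDegree s₁ + qDegree s₂ - 1 ≤ qDegree u := by
  obtain ⟨σ₁, la₁, hla₁⟩ := s₁
  obtain ⟨σ₂, la₂, hla₂⟩ := s₂
  have hst := G.state_eq_of_mergeEntry_ne_zero H hG hH 0 t hm
  obtain ⟨τ, lab, hlab⟩ := u
  simp only at hst
  subst hst
  rw [mergeEntry, if_pos rfl] at hm
  unfold KhFace.mergeInc at hm
  split_ifs at hm with hagree
  · have hlabL : ∀ x y, (G.connSum H).circleOf (Fin.append σ₁ σ₂) x =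
        (G.connSum H).circleOf (Fin.append σ₁ σ₂) y → lab x = lab y := fun x y hxy ↦
      (⟨_, lab, hlab⟩ : (G.connSum H).EnhancedState).label_eq_of_circleOf_eq hxy
    have hq := G.qDegree_ofLab_connSum H hG hH σ₁ la₁ hla₁ σ₂ la₂ hla₂ ⟨lab, hlabL⟩ hagree
    change qDegree (⟨Fin.append σ₁ σ₂, lab, hlab⟩ : (G.connSum H).EnhancedState) = _ at hq
    have hd := labelDeg_sub_ge_of_mergeCoeff_ne_zero hm
    simp only [Sum.elim_inl, Sum.elim_inr, Function.comp_apply, arcEquiv_inl] at hd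
    change -1 ≤ labelDeg (lab (G.inlArc H G.baseArc)) - labelDeg (la₁ G.baseArc) - labelDeg (la₂ H.baseArc) at hd
    rw [hq]
    linarith
  · exact (hm rfl).elim

/-- **Filtration.** If `m₁ ≤ q(x)` and `m₂ ≤ q(y)` for the filtration degrees of degree-zero
chains `x` of `G` and `y` of `H` (Lee's theory over `ℚ`), then `m₁ + m₂ - 1 ≤ q(m(x, y))`.
Rasmussen (2010), Lemma 3.8, §4.2. [cite: Rasmussen2010, Lemma 3.8] -/
theorem le_qMin_mergeMap (t : ℚ) (x : G.degStates 0 → ℚ) (y : H.degStates 0 → ℚ) {m₁ m₂ : ℤ}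
    (h₁ : ((m₁ : WithTop ℤ) : WithBot (WithTop ℤ)) ≤ qMin x)
    (h₂ : ((m₂ : WithTop ℤ) : WithBot (WithTop ℤ)) ≤ qMin y) :
    (((m₁ + m₂ - 1 : ℤ) : WithTop ℤ) : WithBot (WithTop ℤ)) ≤ qMin (G.mergeMap H hG hH 0 t 0 0 0 x y) := by
  rw [coe_le_qMin_iff] at h₁ h₂ ⊢
  intro u hu
  rw [mergeMap_apply] at hu
  obtain ⟨s₁, -, hs₁⟩ := Finset.exists_ne_zero_of_sum_ne_zero hu
  obtain ⟨s₂, -, hs₂⟩ := Finset.exists_ne_zero_of_sum_ne_zero hs₁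
  have hx : x s₁ ≠ 0 := fun h0 ↦ hs₂ (by rw [h0, zero_mul, zero_mul])
  have hy : y s₂ ≠ 0 := fun h0 ↦ hs₂ (by rw [h0, mul_zero, zero_mul])
  have hm : G.mergeEntry H hG hH 0 t s₁.1 s₂.1 u.1 ≠ 0 := fun h0 ↦ hs₂ (by rw [h0, mul_zero])
  have := G.qDegree_ge_of_mergeEntry_ne_zero H hG hH t hm
  have := h₁ s₁ hx
  have := h₂ s₂ hy
  linarith

end Degrees

end GaussDiagram

end Literature.Topology.FourManifolds
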